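import Literature.Analysis.FluidPDE.SelfSimilarEulerPressureRecovery
import Literature.Analysis.FluidPDE.NormalisedPressureDischarge
import Literature.Analysis.FluidPDE.NormalisedPressureAffine
import Literature.Analysis.FluidPDE.LocalLerayPressureDecompositionProofs
import Literature.Analysis.FluidPDE.LerayPressureDecayProofs
import Literature.Analysis.FluidPDE.SteadyNSCaccioppoliTools
import HarnessLib

/-!
# Bronzi–Shvydkoy 2015, Lemma 2.1: the self-similar pressure of a locally self-similar Euler
# blow-up and its dyadic shell bound (2.4)

Analysis/FluidPDE proof file (theorems only; no definitions, no named facts, no `sorry`) in the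
story of `SelfSimilarEulerEnergyConcentration.lean` (the NAMED FACT
`bronziShvydkoy2015_energy_dichotomy` = A. Bronzi, R. Shvydkoy, *On the energy behavior of locally
self-similar blowup for the Euler equation*, Indiana Univ. Math. J. **64** (2015) 1291–1302 =
arXiv:1310.8611 [BronziShvydkoy2015], **Theorem 1.1**), supplying the part of the printed proof
that the tree did not yet have: the analytic content of **Lemma 2.1** (held text p. 5),

> "the scalar function `q ∈ C²_loc` given by `q(y) = −|v(y)|²/N + ∫ K_{ij}(y−z)vᵢ(z)vⱼ(z)dz` (2.2)
> solves the equation (2.3) and satisfies the bound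
> `⟨|q|^r⟩_{L,2L}^{1/r} ≲ ⟨|v|²⟩_L + ⟨|v|^{2r}⟩^{1/r}_{L/2,4L} + Σ_{k≥1} ⟨|v|²⟩_{2^kL,2^{k+1}L}` (2.4)
> for all `r > 1`",

for the exponent `r = 3/2` used in §3, in the setting of the fact: a classical Euler solution
`(u, p)` on `ℝ³ × [0,T)` in the Beale–Kato–Majda class (`IsClassicalEulerSolutionOn (Ico 0 T) 0 u p`,
`HasBoundedSobolevNormsOn`), locally self-similar on `B_{ρ₀}(x₀)`:
`u(t,x) = (T−t)^{γ−1} v((T−t)^{−γ}(x−x₀))` (`selfSimilarCollapse γ T v`), `γ = 1/(α+1) ∈ (0,1)`.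

## The argument (BS15 §2, Steps 2–4, with the tree's pressure normalisation for Steps 3–4)

* **Step 2 (splitting on a dyadic shell).** For `L < |y| < 2L` the principal value
  `p.v.∫ K(y−z)(w z)dz` (`HasPressurePV`, `normalisedPressure` of `NormalisedPressure.lean` — this IS
  the printed (2.2): `p̃[w] = −|w|²/3 + p.v.∫ K(·−z)(w z)dz`) splits along the `z`-regions
  `|z| < L/2` (`J₁`, `|y−z| ≥ L/2`), `L/2 ≤ |z| < 4L` (the only region met by small excised balls:
  a principal value of the truncated field `1_A w`) and `|z| ≥ 4L` (`J₃`, `|y−z| ≥ |z|/2`):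
  `p̃[w](y) = p̃[1_A w](y) + J₁(y) + J₃(y)` (`normalisedPressure_eq_indicator_add`), with
  `|J₁| ≤ (4/(πL³))∫_{|z|<L/2}|w|²`, `|J₃| ≤ (4/π)∫_{|z|≥4L}|w|²/|z|³` and, "by the Calderón–Zygmund
  boundedness", `‖p̃[1_A w]‖_{3/2} ≤ C ‖1_A |w|²‖_{3/2}` (the tree's DISCHARGED Stein fact
  `stein1970_normalisedPressure_ae_Lp_bound_holds`); packaged as the `L^{3/2}` shell law
  `exists_shell_threeHalves_bound`.
* **Steps 3–4 (the pressure of the blow-up is this `q`).** The rescaled slices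
  `ũ_t(z) = (T−t)^{1−γ} u(t, x₀ + (T−t)^γ z)` are smooth, of finite energy
  `‖ũ_t‖₂² = (T−t)^{2−5γ}‖u(t)‖₂² ≤ (T−t)^{2−5γ}‖u(0)‖₂²`, and equal `v` on `|z| < R(t) = ρ₀(T−t)^{−γ}`;
  Tao's normalisation `p(t) = Q[u(t)] + c(t)` (tree `pressure_sub_pressurePotential_eq`,
  `normalisedPressure_eq_pressurePotential`) and the affine covariance of `p̃`
  (`normalisedPressure_smul_comp_affine`) identify the tree's recovered pressure profile `q`
  (`exists_pressureProfile_of_locallySelfSimilar`, `q(0) = 0`) as `q = p̃[ũ_t] − p̃[ũ_t](0)` on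
  `|y| < R(t)` (`pressureProfile_eq_normalisedPressure_rescaledSlice`).  Splitting `p̃[ũ_t]` on a
  shell and letting `t ↑ T` — the `ũ_t`-tail beyond `R(t)` is `≤ (4/π)ρ₀⁻³‖u(0)‖₂²(T−t)^{2−2γ}`
  (printed: "`p̃(y,t) ≲ (T−t)^{2α/(1+α)}‖u‖₂²`"), the `v`-tail is `o(1)` — the constants
  `p̃[ũ_t](0)` converge to some `κ`, and `P = q + κ` satisfies, on EVERY shell `L < |y| < 2L`,
  `P(y) = p̃[1_A v](y) + J₁[v](y) + J₃[v](y)` (`exists_pressureProfile_shell_repr`); whence (2.4):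
  `exists_pressureProfile_shell_bound`.

Main results (namespace `Literature.Analysis.FluidPDE.BronziShvydkoy2015`):

* `normalisedPressure_eq_indicator_add`, `exists_shell_threeHalves_bound` (Step 2, any field);
* `rescaledSlice_eq`, `integrable_rescaledSlice_sq`, `integral_rescaledSlice_sq_le`,
  `pressureProfile_eq_normalisedPressure_rescaledSlice`, `pressureProfile_repr_at_time`,
  `abs_tail_rescaledSlice_le` (Steps 3–4 at time `t`);
* `exists_pressureProfile_shell_repr` — **Lemma 2.1**: a profile pressure `P` with `(v,P)` solving
  (2.3) (`IsSelfSimilarEulerProfile γ 0 v P`) and the shell representation;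
* `exists_pressureProfile_shell_bound` — **Lemma 2.1, bound (2.4) with `r = 3/2`**, universal
  constant, every `L > 0`.

The only extra hypothesis beyond the fact's is the integrability of the far weight `|v|²/|z|³`
near infinity, a consequence of the energy growth (1.6) `∫_{|y|<L}|v|² ≲ L^{3−2α}`, `α > 0`
(tree `energyGrowth_of_locallySelfSimilar`), supplied by the consumer (the §3 bootstrap).

## Mathlib / tree search

Reused (by name): `exists_pressureProfile_of_locallySelfSimilar`, `CIV2026.integrable_sq_norm_and_energy_le`
(`SelfSimilarEulerPressureRecovery`, `PutativeSelfSimilarEulerProofs`); `pressure_sub_pressurePotential_eq`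
(`NormalisedPressureDischarge`); `normalisedPressure_eq_pressurePotential` (`PressureRepresentation`);
`normalisedPressure_smul_comp_affine` (`NormalisedPressureAffine`); `hasPressurePV_of_contDiff_holds`
(`NormalisedPressurePV`); `stein1970_normalisedPressure_ae_Lp_bound_holds`
(`LocalLerayPressureDecompositionProofs`); `abs_pressureKernel_le`, `measurable_pressureKernel`
(`TaoEnergyLocalisationPressure`); `enorm_norm_sq_rpow_threeHalves`, `add_rpow_threeHalves_le`
(`LerayPressureDecayProofs`); `memLp_restrict_of_continuous_isBounded`, `setIntegral_norm_rpow_three_nonneg`,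
`volume_real_le_of_subset_closedBall` (`SteadyNSCaccioppoliTools`).  Mathlib: `setIntegral_union`,
`setIntegral_indicator`, `tendsto_setIntegral_of_antitone`, `Measure.integral_comp_smul_of_nonneg`,
`integral_add_left_eq_self`, `integrable_comp_smul_iff`, `tendsto_rpow_atTop`, `tendsto_inv_nhdsGT_zero`,
`squeeze_zero_norm'`, `tendsto_nhds_unique`, `NNReal.rpow_add_le_add_rpow`.
`lean search 'Lemma 2.1|press-bound|shell.*normalisedPressure'`: nothing of this kind in the tree
(MAP v16 §3b: "BS15 Rem 1.5, Lemma 2.1 — not typed"). No new definitions, no instances, no notation.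
-/

noncomputable section

open MeasureTheory Set Filter Topology Metric
open scoped ENNReal NNReal RealInnerProductSpace

namespace Literature.Analysis.FluidPDE

namespace BronziShvydkoy2015

/-! ## §1 Splitting the principal value along the `z`-domain on a dyadic shell

For `L < |y| < 2L` the singular integral `p.v.∫ K(y−z)(w z) dz` is split according to
`|z| < L/2` (far from `y`: absolutely convergent, `J₁`), `L/2 ≤ |z| < 4L` (the only region met
by the excised balls `|z − y| ≤ ε`, `ε < L/2`: a principal value of the truncated field
`1_A w`) and `|z| ≥ 4L` (`J₃`).  BS15 §2, Step 2: "consider `y` in the shell `{L<|y|<2L}` and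
[split] `J` into three integrals `J₁ = ∫_{|z|<L/2}`, `J₂ = ∫_{L/2<|z|<4L}`, `J₃ = ∫_{|z|>4L}`". -/

variable {w : EuclideanSpace ℝ (Fin 3) → EuclideanSpace ℝ (Fin 3)} {L ε : ℝ}
  {y : EuclideanSpace ℝ (Fin 3)}

/-- The integrand `z ↦ K(y − z)(w z)` is a.e.-strongly measurable for a.e.-strongly measurable `w`.
[folklore] -/
private theorem aestronglyMeasurable_kernel_apply (hw : AEStronglyMeasurable w volume)
    (y : EuclideanSpace ℝ (Fin 3)) :
    AEStronglyMeasurable (fun z => pressureKernel (y - z) (w z)) volume := by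
  have h3 : AEMeasurable (fun z : EuclideanSpace ℝ (Fin 3) => (y - z, w z)) volume :=
    (measurable_const.sub measurable_id).aemeasurable.prodMk hw.aemeasurable
  exact (measurable_pressureKernel.comp_aemeasurable h3).aestronglyMeasurable

/-- On the inner ball `|z| < L/2`, seen from a point `y` of the shell `L < |y| < 2L`, the kernel is
bounded: `|K(y−z)(w z)| ≤ 4|w z|²/(π L³)` (`|y − z| ≥ L/2`). [cite: BronziShvydkoy2015, §2 Lemma 2.1, Step 2 (J₁)] -/
theorem abs_kernel_apply_le_of_mem_ball (hL : 0 < L) (hy : L < ‖y‖)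
    {z : EuclideanSpace ℝ (Fin 3)} (hz : z ∈ ball (0 : EuclideanSpace ℝ (Fin 3)) (L / 2)) :
    |pressureKernel (y - z) (w z)| ≤ 4 / (Real.pi * L ^ 3) * ‖w z‖ ^ 2 := by
  rw [mem_ball_zero_iff] at hz
  have hyz : L / 2 ≤ ‖y - z‖ := by
    have h2 : ‖y‖ - ‖z‖ ≤ ‖y - z‖ := norm_sub_norm_le y z
    linarith
  have hL2 : 0 < L / 2 := by linarith
  calc |pressureKernel (y - z) (w z)| ≤ ‖w z‖ ^ 2 / (2 * Real.pi * ‖y - z‖ ^ 3) :=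
        abs_pressureKernel_le _ _
    _ ≤ ‖w z‖ ^ 2 / (2 * Real.pi * (L / 2) ^ 3) := by
        gcongr
    _ = 4 / (Real.pi * L ^ 3) * ‖w z‖ ^ 2 := by
        field_simp
        ring

/-- Far from `y` (`2|y| ≤ R ≤ |z|`) the kernel is bounded by the integrable weight:
`|K(y−z)(w z)| ≤ (4/π)|w z|²/|z|³` (`|y − z| ≥ |z|/2`). [cite: BronziShvydkoy2015, §2 Lemma 2.1, Step 2 (J₃)] -/
theorem abs_kernel_apply_le_of_far {R : ℝ} (hR : 0 < R) (hy : 2 * ‖y‖ ≤ R)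
    {z : EuclideanSpace ℝ (Fin 3)} (hz : R ≤ ‖z‖) :
    |pressureKernel (y - z) (w z)| ≤ 4 / Real.pi * (‖w z‖ ^ 2 / ‖z‖ ^ 3) := by
  have hz0 : 0 < ‖z‖ := by linarith
  have hyz : ‖z‖ / 2 ≤ ‖y - z‖ := by
    have h2 : ‖z‖ - ‖y‖ ≤ ‖y - z‖ := by
      rw [← norm_neg (y - z), neg_sub]
      exact norm_sub_norm_le z y
    linarith
  have hz2 : 0 < ‖z‖ / 2 := by linarith
  calc |pressureKernel (y - z) (w z)| ≤ ‖w z‖ ^ 2 / (2 * Real.pi * ‖y - z‖ ^ 3) :=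
        abs_pressureKernel_le _ _
    _ ≤ ‖w z‖ ^ 2 / (2 * Real.pi * (‖z‖ / 2) ^ 3) := by
        gcongr
    _ = 4 / Real.pi * (‖w z‖ ^ 2 / ‖z‖ ^ 3) := by
        field_simp
        ring

/-- The kernel integrand is integrable on the inner ball `|z| < L/2` as soon as `w` is square
integrable there. [folklore] -/
private theorem integrableOn_kernel_ball (hw : AEStronglyMeasurable w volume) (hL : 0 < L) (hy : L < ‖y‖)
    (h1 : IntegrableOn (fun z => ‖w z‖ ^ 2) (ball (0 : EuclideanSpace ℝ (Fin 3)) (L / 2)) volume) :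
    IntegrableOn (fun z => pressureKernel (y - z) (w z))
      (ball (0 : EuclideanSpace ℝ (Fin 3)) (L / 2)) volume := by
  refine Integrable.mono' (h1.const_mul (4 / (Real.pi * L ^ 3)))
    (aestronglyMeasurable_kernel_apply hw y).restrict ?_
  rw [ae_restrict_iff' measurableSet_ball]
  refine Eventually.of_forall fun z hz => ?_
  rw [Real.norm_eq_abs]
  exact abs_kernel_apply_le_of_mem_ball hL hy hz

/-- The kernel integrand is integrable on a far region `{|z| ≥ R}`, `R ≥ 2|y|`, as soon as
`|w|²/|z|³` is. [folklore] -/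
private theorem integrableOn_kernel_far (hw : AEStronglyMeasurable w volume) {R : ℝ} (hR : 0 < R)
    (hy : 2 * ‖y‖ ≤ R)
    (h3 : IntegrableOn (fun z => ‖w z‖ ^ 2 / ‖z‖ ^ 3)
      {z : EuclideanSpace ℝ (Fin 3) | R ≤ ‖z‖} volume) :
    IntegrableOn (fun z => pressureKernel (y - z) (w z))
      {z : EuclideanSpace ℝ (Fin 3) | R ≤ ‖z‖} volume := by
  have hm : MeasurableSet {z : EuclideanSpace ℝ (Fin 3) | R ≤ ‖z‖} :=
    (isClosed_le continuous_const continuous_norm).measurableSet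
  refine Integrable.mono' (h3.const_mul (4 / Real.pi))
    (aestronglyMeasurable_kernel_apply hw y).restrict ?_
  rw [ae_restrict_iff' hm]
  refine Eventually.of_forall fun z hz => ?_
  rw [Real.norm_eq_abs]
  exact abs_kernel_apply_le_of_far hR hy hz

/-- `|J₁| ≤ (4/(πL³)) ∫_{|z|<L/2} |w|²`. [cite: BronziShvydkoy2015, §2 Lemma 2.1, Step 2 (J₁)] -/
theorem abs_integral_kernel_ball_le (hL : 0 < L) (hy : L < ‖y‖)
    (h1 : IntegrableOn (fun z => ‖w z‖ ^ 2) (ball (0 : EuclideanSpace ℝ (Fin 3)) (L / 2)) volume) :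
    |∫ z in ball (0 : EuclideanSpace ℝ (Fin 3)) (L / 2), pressureKernel (y - z) (w z)| ≤
      4 / (Real.pi * L ^ 3) * ∫ z in ball (0 : EuclideanSpace ℝ (Fin 3)) (L / 2), ‖w z‖ ^ 2 := by
  rw [← integral_const_mul, ← Real.norm_eq_abs]
  refine norm_integral_le_of_norm_le (h1.const_mul _) ?_
  rw [ae_restrict_iff' measurableSet_ball]
  refine Eventually.of_forall fun z hz => ?_
  rw [Real.norm_eq_abs]
  exact abs_kernel_apply_le_of_mem_ball hL hy hz

/-- `|∫_{|z|≥R} K(y−z)(w z) dz| ≤ (4/π) ∫_{|z|≥R} |w|²/|z|³` for `R ≥ 2|y|` (the bound for `J₃`,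
`R = 4L`). [cite: BronziShvydkoy2015, §2 Lemma 2.1, Step 2 (J₃)] -/
theorem abs_integral_kernel_far_le {R : ℝ} (hR : 0 < R) (hy : 2 * ‖y‖ ≤ R)
    (h3 : IntegrableOn (fun z => ‖w z‖ ^ 2 / ‖z‖ ^ 3)
      {z : EuclideanSpace ℝ (Fin 3) | R ≤ ‖z‖} volume) :
    |∫ z in {z : EuclideanSpace ℝ (Fin 3) | R ≤ ‖z‖}, pressureKernel (y - z) (w z)| ≤
      4 / Real.pi * ∫ z in {z : EuclideanSpace ℝ (Fin 3) | R ≤ ‖z‖}, ‖w z‖ ^ 2 / ‖z‖ ^ 3 := by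
  have hm : MeasurableSet {z : EuclideanSpace ℝ (Fin 3) | R ≤ ‖z‖} :=
    (isClosed_le continuous_const continuous_norm).measurableSet
  rw [← integral_const_mul, ← Real.norm_eq_abs]
  refine norm_integral_le_of_norm_le (h3.const_mul _) ?_
  rw [ae_restrict_iff' hm]
  refine Eventually.of_forall fun z hz => ?_
  rw [Real.norm_eq_abs]
  exact abs_kernel_apply_le_of_far hR hy hz

/-- The kernel integrand of a truncated field is the truncation of the kernel integrand
(`K(z)(0) = 0`). [folklore] -/
private theorem kernel_apply_indicator (A : Set (EuclideanSpace ℝ (Fin 3))) (y : EuclideanSpace ℝ (Fin 3)) :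
    (fun z => pressureKernel (y - z) (A.indicator w z)) =
      A.indicator (fun z => pressureKernel (y - z) (w z)) := by
  funext z
  by_cases hz : z ∈ A
  · rw [indicator_of_mem hz, indicator_of_mem hz]
  · rw [indicator_of_notMem hz, indicator_of_notMem hz, pressureKernel_zero_right]

/-- The middle annulus `A_L = {L/2 ≤ |z| < 4L}` is measurable. [folklore] -/
private theorem measurableSet_annulus (L : ℝ) :
    MeasurableSet {z : EuclideanSpace ℝ (Fin 3) | L / 2 ≤ ‖z‖ ∧ ‖z‖ < 4 * L} :=
  (isClosed_le continuous_const continuous_norm).measurableSet.inter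
    (isOpen_lt continuous_norm continuous_const).measurableSet

/-- The far region `{4L ≤ |z|}` is measurable. [folklore] -/
private theorem measurableSet_far (L : ℝ) :
    MeasurableSet {z : EuclideanSpace ℝ (Fin 3) | 4 * L ≤ ‖z‖} :=
  (isClosed_le continuous_const continuous_norm).measurableSet

/-- **Splitting of the truncated singular integral on a dyadic shell.** For `L < |y| < 2L` and
`0 < ε < L/2` the excised ball `|z − y| ≤ ε` meets neither `|z| < L/2` nor `|z| ≥ 4L`, so
`∫_{|z−y|>ε} K(y−z)(w z) dz = ∫_{|z−y|>ε} K(y−z)(1_A w)(z) dz + J₁(y) + J₃(y)`,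
`A = {L/2 ≤ |z| < 4L}`, `J₁ = ∫_{|z|<L/2} K(y−z)(w z)`, `J₃ = ∫_{|z|≥4L} K(y−z)(w z)`.
[cite: BronziShvydkoy2015, §2 Lemma 2.1, Step 2] -/
theorem truncatedPressureIntegral_eq_indicator_add (hw : AEStronglyMeasurable w volume)
    (hL : 0 < L) (hy : L < ‖y‖ ∧ ‖y‖ < 2 * L) (hε : 0 < ε) (hεL : ε < L / 2)
    (hint : IntegrableOn (fun z => pressureKernel (y - z) (w z)) (closedBall y ε)ᶜ volume)
    (h1 : IntegrableOn (fun z => ‖w z‖ ^ 2) (ball (0 : EuclideanSpace ℝ (Fin 3)) (L / 2)) volume)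
    (h3 : IntegrableOn (fun z => ‖w z‖ ^ 2 / ‖z‖ ^ 3)
      {z : EuclideanSpace ℝ (Fin 3) | 4 * L ≤ ‖z‖} volume) :
    truncatedPressureIntegral w y ε =
      truncatedPressureIntegral
          ({z : EuclideanSpace ℝ (Fin 3) | L / 2 ≤ ‖z‖ ∧ ‖z‖ < 4 * L}.indicator w) y ε +
        (∫ z in ball (0 : EuclideanSpace ℝ (Fin 3)) (L / 2), pressureKernel (y - z) (w z)) +
        ∫ z in {z : EuclideanSpace ℝ (Fin 3) | 4 * L ≤ ‖z‖}, pressureKernel (y - z) (w z) := by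
  set A : Set (EuclideanSpace ℝ (Fin 3)) := {z | L / 2 ≤ ‖z‖ ∧ ‖z‖ < 4 * L} with hA
  set B : Set (EuclideanSpace ℝ (Fin 3)) := ball 0 (L / 2) with hB
  set F : Set (EuclideanSpace ℝ (Fin 3)) := {z | 4 * L ≤ ‖z‖} with hF
  set f : EuclideanSpace ℝ (Fin 3) → ℝ := fun z => pressureKernel (y - z) (w z) with hf
  have hAm : MeasurableSet A := measurableSet_annulus L
  have hFm : MeasurableSet F := measurableSet_far L
  -- geometry
  have hBsub : B ⊆ (closedBall y ε)ᶜ := by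
    intro z hz
    rw [hB, mem_ball_zero_iff] at hz
    rw [mem_compl_iff, mem_closedBall, not_le, dist_eq_norm, ← norm_neg, neg_sub]
    have h2 : ‖y‖ - ‖z‖ ≤ ‖y - z‖ := norm_sub_norm_le y z
    linarith [hy.1]
  have hFsub : F ⊆ (closedBall y ε)ᶜ := by
    intro z hz
    rw [hF, mem_setOf_eq] at hz
    rw [mem_compl_iff, mem_closedBall, not_le, dist_eq_norm]
    have h2 : ‖z‖ - ‖y‖ ≤ ‖z - y‖ := norm_sub_norm_le z y
    linarith [hy.2]
  have hBF : Disjoint B F := by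
    rw [disjoint_left]
    intro z hzB hzF
    rw [hB, mem_ball_zero_iff] at hzB
    rw [hF, mem_setOf_eq] at hzF
    linarith
  have hA_BF : Disjoint ((closedBall y ε)ᶜ ∩ A) (B ∪ F) := by
    rw [disjoint_left]
    rintro z ⟨-, hzA⟩ hz
    rw [hA, mem_setOf_eq] at hzA
    rcases hz with hzB | hzF
    · rw [hB, mem_ball_zero_iff] at hzB
      linarith [hzA.1]
    · rw [hF, mem_setOf_eq] at hzF
      linarith [hzA.2]
  have hunion : (closedBall y ε)ᶜ = ((closedBall y ε)ᶜ ∩ A) ∪ (B ∪ F) := by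
    ext z
    simp only [mem_union, mem_inter_iff]
    constructor
    · intro hz
      by_cases hzB : z ∈ B
      · exact Or.inr (Or.inl hzB)
      by_cases hzF : z ∈ F
      · exact Or.inr (Or.inr hzF)
      refine Or.inl ⟨hz, ?_⟩
      rw [hB, mem_ball_zero_iff, not_lt] at hzB
      rw [hF, mem_setOf_eq, not_le] at hzF
      exact ⟨hzB, hzF⟩
    · rintro (⟨hz, -⟩ | hz | hz)
      · exact hz
      · exact hBsub hz
      · exact hFsub hz
  -- integrability on the pieces
  have hiB : IntegrableOn f B volume := integrableOn_kernel_ball hw hL hy.1 h1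
  have hiF : IntegrableOn f F volume :=
    integrableOn_kernel_far hw (by linarith : 0 < 4 * L) (by linarith [hy.2]) h3
  have hiA : IntegrableOn f ((closedBall y ε)ᶜ ∩ A) volume := hint.mono_set inter_subset_left
  -- the truncated integral of `1_A w`
  have hind : truncatedPressureIntegral (A.indicator w) y ε = ∫ z in (closedBall y ε)ᶜ ∩ A, f z := by
    rw [truncatedPressureIntegral, kernel_apply_indicator A y, setIntegral_indicator hAm]
  have hsplit : ∫ z in (closedBall y ε)ᶜ, f z =
      (∫ z in (closedBall y ε)ᶜ ∩ A, f z) + ((∫ z in B, f z) + ∫ z in F, f z) := by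
    conv_lhs => rw [hunion]
    rw [setIntegral_union hA_BF (measurableSet_ball.union hFm) hiA (hiB.union hiF),
      setIntegral_union hBF hFm hiB hiF]
  rw [hind, truncatedPressureIntegral]
  change ∫ z in (closedBall y ε)ᶜ, f z = _
  rw [hsplit]
  ring

/-- **Principal values correspond under the splitting**: if `p.v.∫ K(y−z)(w z) dz = Λ` at a
point of the shell `L < |y| < 2L`, then the truncated field `1_A w` has principal value
`Λ − J₁(y) − J₃(y)` there. [cite: BronziShvydkoy2015, §2 Lemma 2.1, Step 2] -/
theorem hasPressurePV_indicator (hw : AEStronglyMeasurable w volume) (hL : 0 < L)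
    (hy : L < ‖y‖ ∧ ‖y‖ < 2 * L) {Λ : ℝ} (hPV : HasPressurePV w y Λ)
    (h1 : IntegrableOn (fun z => ‖w z‖ ^ 2) (ball (0 : EuclideanSpace ℝ (Fin 3)) (L / 2)) volume)
    (h3 : IntegrableOn (fun z => ‖w z‖ ^ 2 / ‖z‖ ^ 3)
      {z : EuclideanSpace ℝ (Fin 3) | 4 * L ≤ ‖z‖} volume) :
    HasPressurePV ({z : EuclideanSpace ℝ (Fin 3) | L / 2 ≤ ‖z‖ ∧ ‖z‖ < 4 * L}.indicator w) y
      (Λ - (∫ z in ball (0 : EuclideanSpace ℝ (Fin 3)) (L / 2), pressureKernel (y - z) (w z)) -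
        ∫ z in {z : EuclideanSpace ℝ (Fin 3) | 4 * L ≤ ‖z‖}, pressureKernel (y - z) (w z)) := by
  set A : Set (EuclideanSpace ℝ (Fin 3)) := {z | L / 2 ≤ ‖z‖ ∧ ‖z‖ < 4 * L} with hA
  have hAm : MeasurableSet A := measurableSet_annulus L
  have hsmall : ∀ᶠ ε in 𝓝[>] (0 : ℝ), 0 < ε ∧ ε < L / 2 := by
    have h1 : ∀ᶠ ε in 𝓝[>] (0 : ℝ), 0 < ε := self_mem_nhdsWithin
    have h2 : ∀ᶠ ε in 𝓝[>] (0 : ℝ), ε < L / 2 :=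
      nhdsWithin_le_nhds (Iio_mem_nhds (by linarith : (0 : ℝ) < L / 2))
    exact h1.and h2
  refine ⟨?_, ?_⟩
  · filter_upwards [hPV.1] with ε hε
    rw [kernel_apply_indicator A y]
    exact hε.indicator hAm
  · have hev : ∀ᶠ ε in 𝓝[>] (0 : ℝ),
        truncatedPressureIntegral w y ε -
            (∫ z in ball (0 : EuclideanSpace ℝ (Fin 3)) (L / 2), pressureKernel (y - z) (w z)) -
          (∫ z in {z : EuclideanSpace ℝ (Fin 3) | 4 * L ≤ ‖z‖}, pressureKernel (y - z) (w z)) =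
        truncatedPressureIntegral (A.indicator w) y ε := by
      filter_upwards [hPV.1, hsmall] with ε hint hε
      rw [truncatedPressureIntegral_eq_indicator_add hw hL hy hε.1 hε.2 hint h1 h3]
      ring
    exact ((hPV.2.sub_const _).sub_const _).congr' hev

/-- **The normalised pressure splits on a dyadic shell**: at a point `L < |y| < 2L` where the
principal value of `w` exists,
`p̃[w](y) = p̃[1_A w](y) + J₁(y) + J₃(y)` with `A = {L/2 ≤ |z| < 4L}`,
`J₁(y) = ∫_{|z|<L/2} K(y−z)(w z) dz`, `J₃(y) = ∫_{|z|≥4L} K(y−z)(w z) dz` (both absolutely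
convergent). [cite: BronziShvydkoy2015, §2 Lemma 2.1, Step 2] -/
theorem normalisedPressure_eq_indicator_add (hw : AEStronglyMeasurable w volume) (hL : 0 < L)
    (hy : L < ‖y‖ ∧ ‖y‖ < 2 * L) (hPV : ∃ Λ, HasPressurePV w y Λ)
    (h1 : IntegrableOn (fun z => ‖w z‖ ^ 2) (ball (0 : EuclideanSpace ℝ (Fin 3)) (L / 2)) volume)
    (h3 : IntegrableOn (fun z => ‖w z‖ ^ 2 / ‖z‖ ^ 3)
      {z : EuclideanSpace ℝ (Fin 3) | 4 * L ≤ ‖z‖} volume) :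
    normalisedPressure w y =
      normalisedPressure ({z : EuclideanSpace ℝ (Fin 3) | L / 2 ≤ ‖z‖ ∧ ‖z‖ < 4 * L}.indicator w) y +
        (∫ z in ball (0 : EuclideanSpace ℝ (Fin 3)) (L / 2), pressureKernel (y - z) (w z)) +
        ∫ z in {z : EuclideanSpace ℝ (Fin 3) | 4 * L ≤ ‖z‖}, pressureKernel (y - z) (w z) := by
  obtain ⟨Λ, hΛ⟩ := hPV
  have hyA : y ∈ {z : EuclideanSpace ℝ (Fin 3) | L / 2 ≤ ‖z‖ ∧ ‖z‖ < 4 * L} := by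
    refine ⟨by linarith [hy.1], by linarith [hy.2]⟩
  rw [normalisedPressure_eq hΛ, normalisedPressure_eq (hasPressurePV_indicator hw hL hy hΛ h1 h3),
    indicator_of_mem hyA]
  ring

/-! ## §2 The `L^{3/2}` shell law from the splitting (Calderón–Zygmund for the middle piece)

BS15 (2.4) with `r = 3/2`: `⟨|q|^{3/2}⟩_{L,2L}^{2/3} ≲ ⟨|v|²⟩_L + ⟨|v|³⟩^{2/3}_{L/2,4L} +
Σ_k ⟨|v|²⟩_{2^kL,2^{k+1}L}` — here with the dyadic tail written as the single far weight
`∫_{|z|≥4L} |v|²/|z|³` and un-averaged integrals. -/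

/-- `(a + b)^p ≤ a^p + b^p` for `0 ≤ p ≤ 1` and `a, b ≥ 0` (real form of
`NNReal.rpow_add_le_add_rpow`). [folklore] -/
private theorem add_rpow_le_add_rpow_real {a b p : ℝ} (ha : 0 ≤ a) (hb : 0 ≤ b) (hp : 0 ≤ p)
    (hp1 : p ≤ 1) : (a + b) ^ p ≤ a ^ p + b ^ p := by
  lift a to ℝ≥0 using ha
  lift b to ℝ≥0 using hb
  exact_mod_cast NNReal.rpow_add_le_add_rpow a b hp hp1

/-- `∫ ‖g‖ₑ^{3/2} = ‖g‖_{L^{3/2}}^{3/2}`. [folklore] -/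
private theorem lintegral_enorm_rpow_threeHalves_eq {α : Type*} [MeasurableSpace α] (μ : Measure α)
    {G : Type*} [NormedAddCommGroup G] (g : α → G) :
    ∫⁻ x, ‖g x‖ₑ ^ (3 / 2 : ℝ) ∂μ = eLpNorm g (3 / 2 : ℝ≥0∞) μ ^ (3 / 2 : ℝ) := by
  have h0 : (3 / 2 : ℝ≥0∞) ≠ 0 := (ENNReal.div_pos (by norm_num) (by norm_num)).ne'
  have ht : (3 / 2 : ℝ≥0∞) ≠ ⊤ := ENNReal.div_ne_top (by norm_num) (by norm_num)
  have hr : ((3 / 2 : ℝ≥0∞)).toReal = 3 / 2 := by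
    rw [ENNReal.toReal_div, ENNReal.toReal_ofNat, ENNReal.toReal_ofNat]
  rw [eLpNorm_eq_lintegral_rpow_enorm_toReal h0 ht, hr, one_div,
    ENNReal.rpow_inv_rpow (by norm_num : (3 / 2 : ℝ) ≠ 0)]

/-- `∫_S |f|^{3/2}` as a lower integral, for a function integrable on `S` in that power.
[folklore] -/
private theorem ofReal_setIntegral_abs_rpow_eq {S : Set (EuclideanSpace ℝ (Fin 3))} {f : EuclideanSpace ℝ (Fin 3) → ℝ}
    (hf : IntegrableOn (fun y => |f y| ^ (3 / 2 : ℝ)) S volume) :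
    ENNReal.ofReal (∫ y in S, |f y| ^ (3 / 2 : ℝ)) = ∫⁻ y in S, ‖f y‖ₑ ^ (3 / 2 : ℝ) := by
  rw [ofReal_integral_eq_lintegral_ofReal hf
    (Eventually.of_forall fun y => Real.rpow_nonneg (abs_nonneg _) _)]
  refine lintegral_congr fun y => ?_
  rw [Real.enorm_eq_ofReal_abs, ENNReal.ofReal_rpow_of_nonneg (abs_nonneg _) (by norm_num)]

/-- `∫_S |u|³` as a lower integral (continuous `u`, bounded `S`). [folklore] -/
private theorem ofReal_setIntegral_norm_rpow_three_eq {S : Set (EuclideanSpace ℝ (Fin 3))} (hS : Bornology.IsBounded S)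
    {u : EuclideanSpace ℝ (Fin 3) → EuclideanSpace ℝ (Fin 3)} (hu : Continuous u) :
    ENNReal.ofReal (∫ y in S, ‖u y‖ ^ (3 : ℝ)) = ∫⁻ y in S, ‖u y‖ₑ ^ (3 : ℕ) := by
  have hint : IntegrableOn (fun y => ‖u y‖ ^ (3 : ℝ)) S volume :=
    memLp_one_iff_integrable.1
      (memLp_restrict_of_continuous_isBounded (hu.norm.rpow_const fun _ => Or.inr (by norm_num)) hS 1)
  rw [ofReal_integral_eq_lintegral_ofReal hint
    (Eventually.of_forall fun y => Real.rpow_nonneg (norm_nonneg _) _)]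
  refine lintegral_congr fun y => ?_
  rw [show (‖u y‖ ^ (3 : ℝ)) = ‖u y‖ ^ (3 : ℕ) from by exact_mod_cast Real.rpow_natCast (‖u y‖) 3,
    ENNReal.ofReal_pow (norm_nonneg _), ofReal_norm]

/-- **The `L^{3/2}` shell law (BS15 (2.4), `r = 3/2`).** There is a universal `K ≥ 0` such that:
whenever a function `P`, on the shell `S_L = {L < |y| < 2L}`, is the split normalised pressure
`P(y) = p̃[1_A v](y) + J₁(y) + J₃(y)` of a continuous field `v` (`A = {L/2 ≤ |z| < 4L}`) whose far
weight `|v|²/|z|³` is integrable on `{|z| ≥ 4L}`, and `|P|^{3/2}` is integrable on `S_L`, then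
`(∫_{S_L} |P|^{3/2})^{2/3} ≤ K ((∫_A |v|³)^{2/3} + L² (L⁻³ ∫_{|z|<L/2} |v|² + ∫_{|z|≥4L} |v|²/|z|³))`
(Stein's `L^{3/2}` bound for the middle piece, the pointwise bounds for `J₁`, `J₃`).
[cite: BronziShvydkoy2015, §2 Lemma 2.1 eq. (2.4)] -/
theorem exists_shell_threeHalves_bound :
    ∃ K : ℝ, 0 ≤ K ∧ ∀ (v : EuclideanSpace ℝ (Fin 3) → EuclideanSpace ℝ (Fin 3)) (L : ℝ)
      (P : EuclideanSpace ℝ (Fin 3) → ℝ), Continuous v → 0 < L →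
      IntegrableOn (fun z => ‖v z‖ ^ 2 / ‖z‖ ^ 3) {z : EuclideanSpace ℝ (Fin 3) | 4 * L ≤ ‖z‖} volume →
      IntegrableOn (fun y => |P y| ^ (3 / 2 : ℝ))
        {y : EuclideanSpace ℝ (Fin 3) | L < ‖y‖ ∧ ‖y‖ < 2 * L} volume →
      (∀ y : EuclideanSpace ℝ (Fin 3), L < ‖y‖ ∧ ‖y‖ < 2 * L →
        P y = normalisedPressure
            ({z : EuclideanSpace ℝ (Fin 3) | L / 2 ≤ ‖z‖ ∧ ‖z‖ < 4 * L}.indicator v) y +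
          (∫ z in ball (0 : EuclideanSpace ℝ (Fin 3)) (L / 2), pressureKernel (y - z) (v z)) +
          ∫ z in {z : EuclideanSpace ℝ (Fin 3) | 4 * L ≤ ‖z‖}, pressureKernel (y - z) (v z)) →
      (∫ y in {y : EuclideanSpace ℝ (Fin 3) | L < ‖y‖ ∧ ‖y‖ < 2 * L}, |P y| ^ (3 / 2 : ℝ)) ^ (2 / 3 : ℝ) ≤
        K * ((∫ z in {z : EuclideanSpace ℝ (Fin 3) | L / 2 ≤ ‖z‖ ∧ ‖z‖ < 4 * L}, ‖v z‖ ^ (3 : ℝ)) ^ (2 / 3 : ℝ) +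
          L ^ 2 * (L⁻¹ ^ 3 * (∫ z in ball (0 : EuclideanSpace ℝ (Fin 3)) (L / 2), ‖v z‖ ^ 2) +
            ∫ z in {z : EuclideanSpace ℝ (Fin 3) | 4 * L ≤ ‖z‖}, ‖v z‖ ^ 2 / ‖z‖ ^ 3)) := by
  -- the Calderón–Zygmund constant at `p = 3/2`
  obtain ⟨C, hC⟩ := stein1970_normalisedPressure_ae_Lp_bound_holds (3 / 2)
    ((ENNReal.lt_div_iff_mul_lt (Or.inl two_ne_zero) (Or.inl ENNReal.ofNat_ne_top)).2
      (by norm_num))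
    (lt_top_iff_ne_top.2 (ENNReal.div_ne_top (by norm_num) (by norm_num)))
  -- the volume constant `b₁ = |B₁|^{2/3}`
  set b₁ : ℝ := (volume.real (ball (0 : EuclideanSpace ℝ (Fin 3)) 1)) ^ (2 / 3 : ℝ) with hb₁
  have hb₁0 : 0 ≤ b₁ := Real.rpow_nonneg measureReal_nonneg _
  refine ⟨(2 : ℝ) ^ (1 / 3 : ℝ) * ((C : ℝ) + 16 / Real.pi * b₁), by positivity, ?_⟩
  intro v L P hv hL h3 hPi hrepr
  set S : Set (EuclideanSpace ℝ (Fin 3)) := {y | L < ‖y‖ ∧ ‖y‖ < 2 * L} with hS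
  set A : Set (EuclideanSpace ℝ (Fin 3)) := {z | L / 2 ≤ ‖z‖ ∧ ‖z‖ < 4 * L} with hA
  set F : Set (EuclideanSpace ℝ (Fin 3)) := {z | 4 * L ≤ ‖z‖} with hF
  have hSm : MeasurableSet S :=
    (isOpen_lt continuous_const continuous_norm).measurableSet.inter
      (isOpen_lt continuous_norm continuous_const).measurableSet
  have hAm : MeasurableSet A := measurableSet_annulus L
  have hAbdd : Bornology.IsBounded A := by
    refine (isBounded_ball (x := (0 : EuclideanSpace ℝ (Fin 3))) (r := 4 * L)).subset fun z hz => ?_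
    rw [mem_ball_zero_iff]; exact hz.2
  have hSsub : S ⊆ closedBall (0 : EuclideanSpace ℝ (Fin 3)) (2 * L) := fun y hy => by
    rw [mem_closedBall_zero_iff]; exact hy.2.le
  have hSbdd : Bornology.IsBounded S := isBounded_closedBall.subset hSsub
  -- the truncated field and its Stein bound
  set w : EuclideanSpace ℝ (Fin 3) → EuclideanSpace ℝ (Fin 3) := A.indicator v with hw
  have hwm : AEStronglyMeasurable w volume := hv.aestronglyMeasurable.indicator hAm
  have hw2 : MemLp (fun x => ‖w x‖ ^ 2) (3 / 2 : ℝ≥0∞) volume := by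
    have heq : (fun x => ‖w x‖ ^ 2) = A.indicator (fun x => ‖v x‖ ^ 2) := by
      funext x
      by_cases hx : x ∈ A
      · rw [hw, indicator_of_mem hx, indicator_of_mem hx]
      · rw [hw, indicator_of_notMem hx, indicator_of_notMem hx, norm_zero, zero_pow two_ne_zero]
    rw [heq, memLp_indicator_iff_restrict hAm]
    exact memLp_restrict_of_continuous_isBounded (hv.norm.pow 2) hAbdd _
  obtain ⟨-, hStein⟩ := hC w hwm hw2
  -- `∫ ‖p̃[w]‖ₑ^{3/2} ≤ C^{3/2} ∫_A ‖v‖ₑ³`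
  have h32 : (0 : ℝ) < 3 / 2 := by norm_num
  have hlinw : ∫⁻ x, ‖(‖w x‖ ^ 2 : ℝ)‖ₑ ^ (3 / 2 : ℝ) = ∫⁻ x in A, ‖v x‖ₑ ^ (3 : ℕ) := by
    rw [← lintegral_indicator hAm]
    refine lintegral_congr fun x => ?_
    rw [enorm_norm_sq_rpow_threeHalves, hw, enorm_indicator_eq_indicator_enorm]
    by_cases hx : x ∈ A
    · rw [indicator_of_mem hx, indicator_of_mem hx]
    · rw [indicator_of_notMem hx, indicator_of_notMem hx, zero_pow three_ne_zero]
  have hmid : ∫⁻ x, ‖normalisedPressure w x‖ₑ ^ (3 / 2 : ℝ) ≤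
      (C : ℝ≥0∞) ^ (3 / 2 : ℝ) * ∫⁻ x in A, ‖v x‖ₑ ^ (3 : ℕ) := by
    have e1 : ∫⁻ x, ‖normalisedPressure w x‖ₑ ^ (3 / 2 : ℝ) =
        eLpNorm (normalisedPressure w) (3 / 2 : ℝ≥0∞) volume ^ (3 / 2 : ℝ) :=
      lintegral_enorm_rpow_threeHalves_eq volume (normalisedPressure w)
    have e2 : ∫⁻ x, ‖(‖w x‖ ^ 2 : ℝ)‖ₑ ^ (3 / 2 : ℝ) =
        eLpNorm (fun x => ‖w x‖ ^ 2) (3 / 2 : ℝ≥0∞) volume ^ (3 / 2 : ℝ) :=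
      lintegral_enorm_rpow_threeHalves_eq volume (fun x => ‖w x‖ ^ 2)
    rw [e1, ← hlinw, e2, ← ENNReal.mul_rpow_of_nonneg _ _ h32.le]
    exact ENNReal.rpow_le_rpow hStein h32.le
  -- the two constant pieces
  set M : ℝ := 4 / (Real.pi * L ^ 3) * (∫ z in ball (0 : EuclideanSpace ℝ (Fin 3)) (L / 2), ‖v z‖ ^ 2) +
    4 / Real.pi * ∫ z in F, ‖v z‖ ^ 2 / ‖z‖ ^ 3 with hM
  have hM0 : 0 ≤ M := by
    have i1 : 0 ≤ ∫ z in ball (0 : EuclideanSpace ℝ (Fin 3)) (L / 2), ‖v z‖ ^ 2 :=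
      integral_nonneg fun _ => sq_nonneg _
    have i2 : 0 ≤ ∫ z in F, ‖v z‖ ^ 2 / ‖z‖ ^ 3 :=
      integral_nonneg fun _ => div_nonneg (sq_nonneg _) (pow_nonneg (norm_nonneg _) _)
    positivity
  have h1 : IntegrableOn (fun z => ‖v z‖ ^ 2) (ball (0 : EuclideanSpace ℝ (Fin 3)) (L / 2)) volume :=
    memLp_one_iff_integrable.1 (memLp_restrict_of_continuous_isBounded (hv.norm.pow 2) isBounded_ball 1)
  -- pointwise on the shell: `|P| ≤ |p̃[w]| + M`
  have hpt : ∀ y ∈ S, ‖P y‖ₑ ^ (3 / 2 : ℝ) ≤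
      (2 : ℝ≥0∞) ^ (1 / 2 : ℝ) * (‖normalisedPressure w y‖ₑ ^ (3 / 2 : ℝ) +
        ENNReal.ofReal M ^ (3 / 2 : ℝ)) := by
    intro y hy
    have hb1 := abs_integral_kernel_ball_le (w := v) hL hy.1 h1
    have hb3 := abs_integral_kernel_far_le (w := v) (by linarith : 0 < 4 * L) (by linarith [hy.2]) h3
    have hPle : |P y| ≤ |normalisedPressure w y| + M := by
      rw [hrepr y hy]
      calc |normalisedPressure w y +
              (∫ z in ball (0 : EuclideanSpace ℝ (Fin 3)) (L / 2), pressureKernel (y - z) (v z)) +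
              ∫ z in F, pressureKernel (y - z) (v z)|
          ≤ |normalisedPressure w y| +
              |∫ z in ball (0 : EuclideanSpace ℝ (Fin 3)) (L / 2), pressureKernel (y - z) (v z)| +
              |∫ z in F, pressureKernel (y - z) (v z)| := by
            refine (abs_add_le _ _).trans ?_
            gcongr
            exact abs_add_le _ _
        _ ≤ |normalisedPressure w y| + M := by rw [hM]; linarith
    have henorm : ‖P y‖ₑ ≤ ‖normalisedPressure w y‖ₑ + ENNReal.ofReal M := by
      rw [Real.enorm_eq_ofReal_abs, Real.enorm_eq_ofReal_abs, ← ENNReal.ofReal_add (abs_nonneg _) hM0]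
      exact ENNReal.ofReal_le_ofReal hPle
    exact (ENNReal.rpow_le_rpow henorm h32.le).trans (add_rpow_threeHalves_le _ _)
  -- integrate over the shell
  have hSvol : volume S < ⊤ := hSbdd.measure_lt_top
  have hlin : ∫⁻ y in S, ‖P y‖ₑ ^ (3 / 2 : ℝ) ≤
      (2 : ℝ≥0∞) ^ (1 / 2 : ℝ) * ((C : ℝ≥0∞) ^ (3 / 2 : ℝ) * (∫⁻ x in A, ‖v x‖ₑ ^ (3 : ℕ)) +
        ENNReal.ofReal M ^ (3 / 2 : ℝ) * volume S) := by
    calc ∫⁻ y in S, ‖P y‖ₑ ^ (3 / 2 : ℝ)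
        ≤ ∫⁻ y in S, (2 : ℝ≥0∞) ^ (1 / 2 : ℝ) * (‖normalisedPressure w y‖ₑ ^ (3 / 2 : ℝ) +
            ENNReal.ofReal M ^ (3 / 2 : ℝ)) := setLIntegral_mono' hSm hpt
      _ = (2 : ℝ≥0∞) ^ (1 / 2 : ℝ) * ((∫⁻ y in S, ‖normalisedPressure w y‖ₑ ^ (3 / 2 : ℝ)) +
            ENNReal.ofReal M ^ (3 / 2 : ℝ) * volume S) := by
          rw [lintegral_const_mul' _ _ (ENNReal.rpow_ne_top_of_nonneg (by norm_num) ENNReal.ofNat_ne_top),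
            lintegral_add_right _ measurable_const, lintegral_const, Measure.restrict_apply_univ]
      _ ≤ (2 : ℝ≥0∞) ^ (1 / 2 : ℝ) * ((C : ℝ≥0∞) ^ (3 / 2 : ℝ) * (∫⁻ x in A, ‖v x‖ₑ ^ (3 : ℕ)) +
            ENNReal.ofReal M ^ (3 / 2 : ℝ) * volume S) := by
          gcongr
          exact (setLIntegral_le_lintegral S _).trans hmid
  -- back to real numbers
  set X : ℝ := ∫ z in A, ‖v z‖ ^ (3 : ℝ) with hX
  have hX0 : 0 ≤ X := setIntegral_norm_rpow_three_nonneg v A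
  set V : ℝ := volume.real S with hV
  have hV0 : 0 ≤ V := measureReal_nonneg
  have hreal : ∫ y in S, |P y| ^ (3 / 2 : ℝ) ≤
      (2 : ℝ) ^ (1 / 2 : ℝ) * ((C : ℝ) ^ (3 / 2 : ℝ) * X + M ^ (3 / 2 : ℝ) * V) := by
    have hlhs := ofReal_setIntegral_abs_rpow_eq hPi
    have hXe : ENNReal.ofReal X = ∫⁻ y in A, ‖v y‖ₑ ^ (3 : ℕ) :=
      ofReal_setIntegral_norm_rpow_three_eq hAbdd hv
    have hrhs : (2 : ℝ≥0∞) ^ (1 / 2 : ℝ) * ((C : ℝ≥0∞) ^ (3 / 2 : ℝ) * (∫⁻ x in A, ‖v x‖ₑ ^ (3 : ℕ)) +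
        ENNReal.ofReal M ^ (3 / 2 : ℝ) * volume S) =
        ENNReal.ofReal ((2 : ℝ) ^ (1 / 2 : ℝ) * ((C : ℝ) ^ (3 / 2 : ℝ) * X + M ^ (3 / 2 : ℝ) * V)) := by
      have e2 : ENNReal.ofReal ((2 : ℝ) ^ (1 / 2 : ℝ)) = (2 : ℝ≥0∞) ^ (1 / 2 : ℝ) := by
        rw [← ENNReal.ofReal_rpow_of_nonneg (by norm_num) (by norm_num), ENNReal.ofReal_ofNat]
      have eC : ENNReal.ofReal ((C : ℝ) ^ (3 / 2 : ℝ)) = (C : ℝ≥0∞) ^ (3 / 2 : ℝ) := by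
        rw [← ENNReal.ofReal_rpow_of_nonneg C.coe_nonneg (by norm_num), ENNReal.ofReal_coe_nnreal]
      have eM : ENNReal.ofReal (M ^ (3 / 2 : ℝ)) = ENNReal.ofReal M ^ (3 / 2 : ℝ) := by
        rw [ENNReal.ofReal_rpow_of_nonneg hM0 (by norm_num)]
      have eV : ENNReal.ofReal V = volume S := ENNReal.ofReal_toReal hSvol.ne
      have hCX : 0 ≤ (C : ℝ) ^ (3 / 2 : ℝ) * X := by positivity
      have hMV' : 0 ≤ M ^ (3 / 2 : ℝ) * V := by positivity
      rw [ENNReal.ofReal_mul (by positivity), ENNReal.ofReal_add hCX hMV',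
        ENNReal.ofReal_mul (by positivity), ENNReal.ofReal_mul (by positivity), e2, eC, eM, eV, hXe]
    have := hlhs ▸ hlin
    rw [hrhs] at this
    exact (ENNReal.ofReal_le_ofReal_iff (by positivity)).1 this
  -- raise to the power `2/3`
  have hI0 : 0 ≤ ∫ y in S, |P y| ^ (3 / 2 : ℝ) :=
    integral_nonneg fun _ => Real.rpow_nonneg (abs_nonneg _) _
  have h23 : (0 : ℝ) ≤ 2 / 3 := by norm_num
  have hpow := Real.rpow_le_rpow hI0 hreal h23
  have e32 : ∀ {x : ℝ}, 0 ≤ x → (x ^ (3 / 2 : ℝ)) ^ (2 / 3 : ℝ) = x := fun hx => by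
    rw [← Real.rpow_mul hx]; norm_num
  have hsplit2 : ((2 : ℝ) ^ (1 / 2 : ℝ) * ((C : ℝ) ^ (3 / 2 : ℝ) * X + M ^ (3 / 2 : ℝ) * V)) ^ (2 / 3 : ℝ) ≤
      (2 : ℝ) ^ (1 / 3 : ℝ) * ((C : ℝ) * X ^ (2 / 3 : ℝ) + M * V ^ (2 / 3 : ℝ)) := by
    rw [Real.mul_rpow (by positivity) (by positivity), ← Real.rpow_mul (by norm_num : (0:ℝ) ≤ 2)]
    have e : (1 / 2 : ℝ) * (2 / 3) = 1 / 3 := by norm_num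
    rw [e]
    gcongr
    calc (((C : ℝ) ^ (3 / 2 : ℝ) * X + M ^ (3 / 2 : ℝ) * V)) ^ (2 / 3 : ℝ)
        ≤ ((C : ℝ) ^ (3 / 2 : ℝ) * X) ^ (2 / 3 : ℝ) + (M ^ (3 / 2 : ℝ) * V) ^ (2 / 3 : ℝ) :=
          add_rpow_le_add_rpow_real (by positivity) (by positivity) h23 (by norm_num)
      _ = (C : ℝ) * X ^ (2 / 3 : ℝ) + M * V ^ (2 / 3 : ℝ) := by
          rw [Real.mul_rpow (by positivity) hX0, Real.mul_rpow (by positivity) hV0,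
            e32 (NNReal.coe_nonneg C), e32 hM0]
  -- `V^{2/3} ≤ 4 b₁ L²`
  have hV23 : V ^ (2 / 3 : ℝ) ≤ 4 * b₁ * L ^ 2 := by
    have hVle : V ≤ (2 * L) ^ Module.finrank ℝ (EuclideanSpace ℝ (Fin 3)) *
        volume.real (ball (0 : EuclideanSpace ℝ (Fin 3)) 1) :=
      volume_real_le_of_subset_closedBall (by positivity) hSsub
    rw [finrank_euclideanSpace_fin] at hVle
    calc V ^ (2 / 3 : ℝ) ≤ ((2 * L) ^ 3 * volume.real (ball (0 : EuclideanSpace ℝ (Fin 3)) 1)) ^ (2 / 3 : ℝ) :=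
          Real.rpow_le_rpow hV0 hVle h23
      _ = 4 * b₁ * L ^ 2 := by
          rw [Real.mul_rpow (by positivity) measureReal_nonneg, ← hb₁]
          have : ((2 * L) ^ 3 : ℝ) ^ (2 / 3 : ℝ) = (2 * L) ^ 2 := by
            rw [show ((2 * L) ^ 3 : ℝ) = (2 * L) ^ ((3 : ℕ) : ℝ) from (Real.rpow_natCast _ 3).symm,
              ← Real.rpow_mul (by positivity)]
            norm_num
          rw [this]; ring
  -- `M (4 b₁ L²) = (16 b₁/π) L² (L⁻³ ∫_B |v|² + ∫_F |v|²/|z|³)`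
  have hMV : M * V ^ (2 / 3 : ℝ) ≤ 16 / Real.pi * b₁ *
      (L ^ 2 * (L⁻¹ ^ 3 * (∫ z in ball (0 : EuclideanSpace ℝ (Fin 3)) (L / 2), ‖v z‖ ^ 2) +
        ∫ z in F, ‖v z‖ ^ 2 / ‖z‖ ^ 3)) := by
    have := mul_le_mul_of_nonneg_left hV23 hM0
    refine this.trans (le_of_eq ?_)
    have hL0 : L ≠ 0 := hL.ne'
    have hπ : Real.pi ≠ 0 := Real.pi_pos.ne'
    rw [hM]
    field_simp
    ring
  calc (∫ y in S, |P y| ^ (3 / 2 : ℝ)) ^ (2 / 3 : ℝ)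
      ≤ ((2 : ℝ) ^ (1 / 2 : ℝ) * ((C : ℝ) ^ (3 / 2 : ℝ) * X + M ^ (3 / 2 : ℝ) * V)) ^ (2 / 3 : ℝ) := hpow
    _ ≤ (2 : ℝ) ^ (1 / 3 : ℝ) * ((C : ℝ) * X ^ (2 / 3 : ℝ) + M * V ^ (2 / 3 : ℝ)) := hsplit2
    _ ≤ (2 : ℝ) ^ (1 / 3 : ℝ) * ((C : ℝ) * X ^ (2 / 3 : ℝ) + 16 / Real.pi * b₁ *
          (L ^ 2 * (L⁻¹ ^ 3 * (∫ z in ball (0 : EuclideanSpace ℝ (Fin 3)) (L / 2), ‖v z‖ ^ 2) +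
            ∫ z in F, ‖v z‖ ^ 2 / ‖z‖ ^ 3))) := by gcongr
    _ ≤ (2 : ℝ) ^ (1 / 3 : ℝ) * ((C : ℝ) + 16 / Real.pi * b₁) * (X ^ (2 / 3 : ℝ) +
          L ^ 2 * (L⁻¹ ^ 3 * (∫ z in ball (0 : EuclideanSpace ℝ (Fin 3)) (L / 2), ‖v z‖ ^ 2) +
            ∫ z in F, ‖v z‖ ^ 2 / ‖z‖ ^ 3)) := by
        have hX23 : 0 ≤ X ^ (2 / 3 : ℝ) := Real.rpow_nonneg hX0 _
        have hT : 0 ≤ L ^ 2 * (L⁻¹ ^ 3 * (∫ z in ball (0 : EuclideanSpace ℝ (Fin 3)) (L / 2), ‖v z‖ ^ 2) +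
            ∫ z in F, ‖v z‖ ^ 2 / ‖z‖ ^ 3) := by
          have i1 : 0 ≤ ∫ z in ball (0 : EuclideanSpace ℝ (Fin 3)) (L / 2), ‖v z‖ ^ 2 :=
            integral_nonneg fun _ => sq_nonneg _
          have i2 : 0 ≤ ∫ z in F, ‖v z‖ ^ 2 / ‖z‖ ^ 3 :=
            integral_nonneg fun _ => div_nonneg (sq_nonneg _) (pow_nonneg (norm_nonneg _) _)
          positivity
        have hCn : 0 ≤ (C : ℝ) := NNReal.coe_nonneg C
        have hbn : 0 ≤ 16 / Real.pi * b₁ := by positivity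
        have h2n : 0 ≤ (2 : ℝ) ^ (1 / 3 : ℝ) := by positivity
        nlinarith [mul_nonneg hCn hT, mul_nonneg hbn hX23, h2n]

/-! ## §3 The recovered pressure of a locally self-similar blow-up (BS15 Lemma 2.1)

Setting of the fact `bronziShvydkoy2015_energy_dichotomy`: a classical Euler solution `(u, p)` on
`ℝ³ × [0,T)` in the Beale–Kato–Majda class, locally self-similar on `B_{ρ₀}(x₀)` with profile `v`
and exponent `γ ∈ (0,1)` (`γ = 1/(α+1)`, `α > 0`).  The RESCALED SLICES
`ũ_t(z) = (T−t)^{1−γ} u(t, x₀ + (T−t)^γ z)` are smooth, of finite energy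
`‖ũ_t‖₂² = (T−t)^{2−5γ} ‖u(t)‖₂²`, and coincide with `v` on the growing balls `|z| < ρ₀(T−t)^{−γ}`
(BS15 §2 Step 3); by Tao's pressure normalisation (tree `pressure_sub_pressurePotential_eq`) and
the affine covariance of the normalised pressure, the tree's pressure profile `q` (with `q(0) = 0`)
is `q = p̃[ũ_t] − p̃[ũ_t](0)` on those balls (BS15 Step 3–4). -/

section LocallySelfSimilar

variable {T γ ρ₀ : ℝ} {x₀ : EuclideanSpace ℝ (Fin 3)}
  {u : ℝ → EuclideanSpace ℝ (Fin 3) → EuclideanSpace ℝ (Fin 3)}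
  {p : ℝ → EuclideanSpace ℝ (Fin 3) → ℝ}
  {v : EuclideanSpace ℝ (Fin 3) → EuclideanSpace ℝ (Fin 3)} {q : EuclideanSpace ℝ (Fin 3) → ℝ}

/-- **The rescaled slice is the profile on the rescaled ball**:
`(T−t)^{1−γ} u(t, x₀ + (T−t)^γ z) = v(z)` for `|z| < ρ₀ (T−t)^{−γ}`. [cite: BronziShvydkoy2015, §2 Lemma 2.1, Step 3] -/
theorem rescaledSlice_eq (hss : ∀ t ∈ Ico 0 T, ∀ x ∈ ball x₀ ρ₀,
      u t x = selfSimilarCollapse γ T v t (x - x₀))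
    {t : ℝ} (ht : t ∈ Ico 0 T) {z : EuclideanSpace ℝ (Fin 3)} (hz : ‖z‖ < ρ₀ * (T - t) ^ (-γ)) :
    (T - t) ^ (1 - γ) • u t (x₀ + (T - t) ^ γ • z) = v z := by
  have hs : 0 < T - t := by linarith [ht.2]
  have hsg : 0 < (T - t) ^ γ := Real.rpow_pos_of_pos hs _
  have hx : x₀ + (T - t) ^ γ • z ∈ ball x₀ ρ₀ := by
    rw [mem_ball, dist_eq_norm, add_sub_cancel_left, norm_smul, Real.norm_of_nonneg hsg.le]
    calc (T - t) ^ γ * ‖z‖ < (T - t) ^ γ * (ρ₀ * (T - t) ^ (-γ)) :=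
          mul_lt_mul_of_pos_left hz hsg
      _ = ρ₀ := by
          rw [Real.rpow_neg hs.le]; field_simp
  rw [hss t ht _ hx, selfSimilarCollapse_apply, add_sub_cancel_left, smul_smul, smul_smul,
    ← Real.rpow_add hs, ← Real.rpow_add hs]
  norm_num

/-- The rescaled slice is smooth. [folklore] -/
private theorem contDiff_rescaledSlice (hsol : IsClassicalEulerSolutionOn (Ico 0 T) 0 u p) {t : ℝ}
    (ht : t ∈ Ico 0 T) (n : ℕ) :
    ContDiff ℝ n (fun z => (T - t) ^ (1 - γ) • u t (x₀ + (T - t) ^ γ • z)) := by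
  have hu : ContDiff ℝ n (u t) := contDiff_infty.1 (hsol.contDiff_velocity ht) n
  have h1 : ContDiff ℝ n (fun z : EuclideanSpace ℝ (Fin 3) => x₀ + (T - t) ^ γ • z) :=
    contDiff_const.add (contDiff_id.const_smul _)
  have h2 := (hu.comp h1).const_smul ((T - t) ^ (1 - γ))
  simpa [Function.comp] using h2

/-- **Energy of the rescaled slice**: `∫ |ũ_t|² = (T−t)^{2(1−γ)} ((T−t)^γ)⁻³ ∫ |u(t)|²`, and
`|ũ_t|²` is integrable. [cite: BronziShvydkoy2015, §1 eq. (1.5)] -/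
theorem integrable_rescaledSlice_sq (hsol : IsClassicalEulerSolutionOn (Ico 0 T) 0 u p)
    (hreg : ∀ T'' < T, HasBoundedSobolevNormsOn (Icc 0 T'') u) {t : ℝ} (ht : t ∈ Ico 0 T) :
    Integrable (fun z => ‖(T - t) ^ (1 - γ) • u t (x₀ + (T - t) ^ γ • z)‖ ^ 2) ∧
      ∫ z, ‖(T - t) ^ (1 - γ) • u t (x₀ + (T - t) ^ γ • z)‖ ^ 2 =
        ((T - t) ^ (1 - γ)) ^ 2 * (((T - t) ^ γ) ^ 3)⁻¹ * ∫ x, ‖u t x‖ ^ 2 := by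
  have hs : 0 < T - t := by linarith [ht.2]
  have hsg : 0 < (T - t) ^ γ := Real.rpow_pos_of_pos hs _
  obtain ⟨hint, -⟩ := CIV2026.integrable_sq_norm_and_energy_le hsol hreg ht
  set f : EuclideanSpace ℝ (Fin 3) → ℝ := fun x => ‖u t x‖ ^ 2 with hf
  have e : ∀ z, ‖(T - t) ^ (1 - γ) • u t (x₀ + (T - t) ^ γ • z)‖ ^ 2 =
      ((T - t) ^ (1 - γ)) ^ 2 * (fun w => f (x₀ + w)) ((T - t) ^ γ • z) := by
    intro z
    rw [norm_smul, mul_pow, Real.norm_of_nonneg (Real.rpow_nonneg hs.le _)]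
  have hint' : Integrable (fun w => f (x₀ + w)) := hint.comp_add_left x₀
  have hint'' : Integrable (fun z => (fun w => f (x₀ + w)) ((T - t) ^ γ • z)) :=
    (integrable_comp_smul_iff volume (fun w => f (x₀ + w)) hsg.ne').2 hint'
  refine ⟨(hint''.const_mul _).congr (Eventually.of_forall fun z => (e z).symm), ?_⟩
  simp_rw [e]
  have hcs : ∫ z, f (x₀ + (T - t) ^ γ • z) = (((T - t) ^ γ) ^ 3)⁻¹ * ∫ x, f x := by
    have h := Measure.integral_comp_smul_of_nonneg volume (fun w => f (x₀ + w)) ((T - t) ^ γ)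
      (hR := hsg.le)
    simp only [finrank_euclideanSpace_fin, smul_eq_mul] at h
    rw [h, integral_add_left_eq_self f x₀]
  rw [integral_const_mul]
  erw [hcs]
  ring

/-- Energy bound of the rescaled slice: `∫ |ũ_t|² ≤ (T−t)^{2−5γ} ‖u(0)‖₂²`. [cite: BronziShvydkoy2015, §1 eq. (1.5)–(1.6)] -/
theorem integral_rescaledSlice_sq_le (hsol : IsClassicalEulerSolutionOn (Ico 0 T) 0 u p)
    (hreg : ∀ T'' < T, HasBoundedSobolevNormsOn (Icc 0 T'') u) {t : ℝ} (ht : t ∈ Ico 0 T) :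
    ∫ z, ‖(T - t) ^ (1 - γ) • u t (x₀ + (T - t) ^ γ • z)‖ ^ 2 ≤
      (T - t) ^ (2 - 5 * γ) * ∫ x, ‖u 0 x‖ ^ 2 := by
  have hs : 0 < T - t := by linarith [ht.2]
  obtain ⟨-, hE⟩ := CIV2026.integrable_sq_norm_and_energy_le hsol hreg ht
  rw [(integrable_rescaledSlice_sq hsol hreg ht).2]
  have e : ((T - t) ^ (1 - γ)) ^ 2 * (((T - t) ^ γ) ^ 3)⁻¹ = (T - t) ^ (2 - 5 * γ) := by
    rw [← Real.rpow_natCast ((T - t) ^ (1 - γ)), ← Real.rpow_natCast ((T - t) ^ γ),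
      ← Real.rpow_mul hs.le, ← Real.rpow_mul hs.le, ← Real.rpow_neg hs.le, ← Real.rpow_add hs]
    norm_num; ring_nf
  rw [e]
  exact mul_le_mul_of_nonneg_left hE (Real.rpow_nonneg hs.le _)

/-- Finite energy in the `∫⁻ ‖·‖ₑ²` form (the hypothesis shape of `hasPressurePV_of_contDiff`). [folklore] -/
private theorem lintegral_enorm_sq_lt_top_of_integrable_sq {f : EuclideanSpace ℝ (Fin 3) → EuclideanSpace ℝ (Fin 3)}
    (hf : Integrable (fun z => ‖f z‖ ^ 2)) : (∫⁻ z, ‖f z‖ₑ ^ 2) < ⊤ := by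
  have e : ∀ z, ‖f z‖ₑ ^ 2 = ENNReal.ofReal (‖f z‖ ^ 2) := fun z => by
    rw [← ofReal_norm, ENNReal.ofReal_pow (norm_nonneg _)]
  simp_rw [e]
  rw [← ofReal_integral_eq_lintegral_ofReal hf (Eventually.of_forall fun z => sq_nonneg _)]
  exact ENNReal.ofReal_lt_top

/-- **The pressure profile is the normalised pressure of the rescaled slice** (BS15 Lemma 2.1,
Steps 3–4, with Tao's pressure normalisation in place of the tempered-distribution argument): for
`t ∈ (0,T)` and `|y| < ρ₀(T−t)^{−γ}`,
`q(y) = p̃[ũ_t](y) − p̃[ũ_t](0)`, where `q` is the pressure profile with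
`p(t,x) = (T−t)^{2(γ−1)} q((T−t)^{−γ}(x−x₀)) + p(t,x₀)` on the ball.
[cite: BronziShvydkoy2015, §2 Lemma 2.1, Steps 3–4] -/
theorem pressureProfile_eq_normalisedPressure_rescaledSlice
    (hsol : IsClassicalEulerSolutionOn (Ico 0 T) 0 u p)
    (hreg : ∀ T'' < T, HasBoundedSobolevNormsOn (Icc 0 T'') u)
    (hqp : ∀ t ∈ Ico 0 T, ∀ x ∈ ball x₀ ρ₀,
      p t x = (T - t) ^ (2 * (γ - 1)) * q ((T - t) ^ (-γ) • (x - x₀)) + p t x₀)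
    {t : ℝ} (ht : t ∈ Ioo 0 T) {y : EuclideanSpace ℝ (Fin 3)} (hy : ‖y‖ < ρ₀ * (T - t) ^ (-γ)) :
    q y = normalisedPressure (fun z => (T - t) ^ (1 - γ) • u t (x₀ + (T - t) ^ γ • z)) y -
      normalisedPressure (fun z => (T - t) ^ (1 - γ) • u t (x₀ + (T - t) ^ γ • z)) 0 := by
  have hs : 0 < T - t := by linarith [ht.2]
  have hsg : 0 < (T - t) ^ γ := Real.rpow_pos_of_pos hs _
  have htI : t ∈ Ico 0 T := ⟨ht.1.le, ht.2⟩
  -- the point `x = x₀ + (T−t)^γ y` lies in the ball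
  have hx : x₀ + (T - t) ^ γ • y ∈ ball x₀ ρ₀ := by
    rw [mem_ball, dist_eq_norm, add_sub_cancel_left, norm_smul, Real.norm_of_nonneg hsg.le]
    calc (T - t) ^ γ * ‖y‖ < (T - t) ^ γ * (ρ₀ * (T - t) ^ (-γ)) :=
          mul_lt_mul_of_pos_left hy hsg
      _ = ρ₀ := by rw [Real.rpow_neg hs.le]; field_simp
  have h1 := hqp t htI _ hx
  rw [add_sub_cancel_left, smul_smul, Real.rpow_neg hs.le, inv_mul_cancel₀ hsg.ne', one_smul] at h1
  -- Tao's normalisation on the closed frame `[0, T']`, `T' = (t+T)/2`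
  set T' : ℝ := (t + T) / 2 with hT'
  have hT'T : T' < T := by rw [hT']; linarith [ht.2]
  have htT' : t < T' := by rw [hT']; linarith [ht.2]
  have hsub : Icc 0 T' ⊆ Ico 0 T := fun τ hτ => ⟨hτ.1, hτ.2.trans_lt hT'T⟩
  have hsol' : IsClassicalNSSolutionOn (Icc 0 T') 0 0 u p :=
    hsol.mono hsub (uniqueDiffOn_Icc (by linarith [ht.1]))
  have hint : ∀ τ ∈ Icc 0 T', Integrable fun x => ‖u τ x‖ ^ 2 := fun τ hτ =>
    (CIV2026.integrable_sq_norm_and_energy_le hsol hreg (hsub hτ)).1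
  have hE : ∀ τ ∈ Icc 0 T', ∫ x, ‖u τ x‖ ^ 2 ≤ ∫ x, ‖u 0 x‖ ^ 2 := fun τ hτ =>
    (CIV2026.integrable_sq_norm_and_energy_le hsol hreg (hsub hτ)).2
  have hE₀ : 0 ≤ ∫ x, ‖u 0 x‖ ^ 2 := integral_nonneg fun _ => sq_nonneg _
  have htI' : t ∈ Ioo 0 T' := ⟨ht.1, htT'⟩
  have h2 := pressure_sub_pressurePotential_eq le_rfl hsol' hE₀ hint hE htI' (x₀ + (T - t) ^ γ • y)
  have h3 := pressure_sub_pressurePotential_eq le_rfl hsol' hE₀ hint hE htI' x₀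
  -- `Q[u t] = p̃[u t]` (finite energy, `C²`)
  have hu2 : ContDiff ℝ 2 (u t) := contDiff_infty.1 (hsol.contDiff_velocity htI) 2
  have hQ : ∀ x, pressurePotential (u t) x = normalisedPressure (u t) x := fun x =>
    (normalisedPressure_eq_pressurePotential hu2 (hint t ⟨ht.1.le, htT'.le⟩) x).symm
  -- affine covariance
  have h4 := normalisedPressure_smul_comp_affine (u t) x₀ ((T - t) ^ (1 - γ)) hsg y
  have h5 := normalisedPressure_smul_comp_affine (u t) x₀ ((T - t) ^ (1 - γ)) hsg 0
  rw [smul_zero, add_zero] at h5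
  rw [hQ, hQ] at h2 h3
  rw [h4, h5]
  -- algebra: `(T−t)^{2(γ−1)} ((T−t)^{1−γ})² = 1`
  have hc : ((T - t) ^ (1 - γ)) ^ 2 * (T - t) ^ (2 * (γ - 1)) = 1 := by
    rw [← Real.rpow_natCast ((T - t) ^ (1 - γ)), ← Real.rpow_mul hs.le, ← Real.rpow_add hs]
    have e0 : (1 - γ) * ((2 : ℕ) : ℝ) + 2 * (γ - 1) = 0 := by push_cast; ring
    rw [e0, Real.rpow_zero]
  have key : (T - t) ^ (2 * (γ - 1)) * q y =
      normalisedPressure (u t) (x₀ + (T - t) ^ γ • y) - normalisedPressure (u t) x₀ := by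
    linarith [h1, h2, h3]
  calc q y = ((T - t) ^ (1 - γ)) ^ 2 * ((T - t) ^ (2 * (γ - 1)) * q y) := by
        rw [← mul_assoc, hc, one_mul]
    _ = _ := by rw [key]; ring

/-- The far weight of a finite-energy field is integrable on `{|z| ≥ R}`, `R > 0`. [folklore] -/
private theorem integrableOn_far_weight_of_integrable_sq {f : EuclideanSpace ℝ (Fin 3) → EuclideanSpace ℝ (Fin 3)}
    (hf : Continuous f) (hf2 : Integrable (fun z => ‖f z‖ ^ 2)) {R : ℝ} (hR : 0 < R) :
    IntegrableOn (fun z => ‖f z‖ ^ 2 / ‖z‖ ^ 3) {z : EuclideanSpace ℝ (Fin 3) | R ≤ ‖z‖} volume := by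
  have hm : MeasurableSet {z : EuclideanSpace ℝ (Fin 3) | R ≤ ‖z‖} :=
    (isClosed_le continuous_const continuous_norm).measurableSet
  refine Integrable.mono' ((hf2.integrableOn).const_mul (R⁻¹ ^ 3))
    ((hf.norm.pow 2).measurable.div (continuous_norm.pow 3).measurable).aestronglyMeasurable.restrict ?_
  rw [ae_restrict_iff' hm]
  refine Eventually.of_forall fun z hz => ?_
  have hz0 : 0 < ‖z‖ := hR.trans_le hz
  rw [Real.norm_eq_abs, abs_of_nonneg (div_nonneg (sq_nonneg _) (pow_nonneg hz0.le _)),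
    div_eq_mul_inv, mul_comm]
  gcongr
  rw [← inv_pow]
  gcongr
  exact hz

/-- `∫_{|z|≥R} |f|²/|z|³ ≤ R⁻³ ∫ |f|²` for a finite-energy field. [folklore] -/
private theorem setIntegral_far_weight_le {f : EuclideanSpace ℝ (Fin 3) → EuclideanSpace ℝ (Fin 3)}
    (hf : Continuous f) (hf2 : Integrable (fun z => ‖f z‖ ^ 2)) {R : ℝ} (hR : 0 < R) :
    ∫ z in {z : EuclideanSpace ℝ (Fin 3) | R ≤ ‖z‖}, ‖f z‖ ^ 2 / ‖z‖ ^ 3 ≤ R⁻¹ ^ 3 * ∫ z, ‖f z‖ ^ 2 := by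
  have hm : MeasurableSet {z : EuclideanSpace ℝ (Fin 3) | R ≤ ‖z‖} :=
    (isClosed_le continuous_const continuous_norm).measurableSet
  calc ∫ z in {z : EuclideanSpace ℝ (Fin 3) | R ≤ ‖z‖}, ‖f z‖ ^ 2 / ‖z‖ ^ 3
      ≤ ∫ z in {z : EuclideanSpace ℝ (Fin 3) | R ≤ ‖z‖}, R⁻¹ ^ 3 * ‖f z‖ ^ 2 := by
        refine setIntegral_mono_on (integrableOn_far_weight_of_integrable_sq hf hf2 hR)
          ((hf2.const_mul _).integrableOn) hm fun z hz => ?_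
        have hz0 : 0 < ‖z‖ := hR.trans_le hz
        rw [div_eq_mul_inv, mul_comm]
        gcongr
        rw [← inv_pow]
        gcongr
        exact hz
    _ = R⁻¹ ^ 3 * ∫ z in {z : EuclideanSpace ℝ (Fin 3) | R ≤ ‖z‖}, ‖f z‖ ^ 2 := integral_const_mul _ _
    _ ≤ R⁻¹ ^ 3 * ∫ z, ‖f z‖ ^ 2 :=
        mul_le_mul_of_nonneg_left
          (setIntegral_le_integral hf2 (Eventually.of_forall fun _ => sq_nonneg _)) (by positivity)

/-- Splitting a far integral at a larger radius: `∫_{|z|≥R₁} = ∫_{R₁≤|z|<R₂} + ∫_{|z|≥R₂}`. [folklore] -/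
private theorem setIntegral_far_split {g : EuclideanSpace ℝ (Fin 3) → ℝ} {R₁ R₂ : ℝ} (hR : R₁ ≤ R₂)
    (hg : IntegrableOn g {z : EuclideanSpace ℝ (Fin 3) | R₁ ≤ ‖z‖} volume) :
    ∫ z in {z : EuclideanSpace ℝ (Fin 3) | R₁ ≤ ‖z‖}, g z =
      (∫ z in {z : EuclideanSpace ℝ (Fin 3) | R₁ ≤ ‖z‖ ∧ ‖z‖ < R₂}, g z) +
        ∫ z in {z : EuclideanSpace ℝ (Fin 3) | R₂ ≤ ‖z‖}, g z := by
  have hm2 : MeasurableSet {z : EuclideanSpace ℝ (Fin 3) | R₂ ≤ ‖z‖} :=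
    (isClosed_le continuous_const continuous_norm).measurableSet
  have hunion : {z : EuclideanSpace ℝ (Fin 3) | R₁ ≤ ‖z‖} =
      {z | R₁ ≤ ‖z‖ ∧ ‖z‖ < R₂} ∪ {z | R₂ ≤ ‖z‖} := by
    ext z
    simp only [mem_setOf_eq, mem_union]
    constructor
    · intro h
      by_cases h2 : ‖z‖ < R₂
      · exact Or.inl ⟨h, h2⟩
      · exact Or.inr (not_lt.1 h2)
    · rintro (⟨h, -⟩ | h)
      · exact h
      · exact hR.trans h
  have hdisj : Disjoint {z : EuclideanSpace ℝ (Fin 3) | R₁ ≤ ‖z‖ ∧ ‖z‖ < R₂} {z | R₂ ≤ ‖z‖} := by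
    rw [disjoint_left]
    rintro z ⟨-, hz⟩ hz'
    exact absurd hz (not_lt.2 hz')
  rw [hunion, setIntegral_union hdisj hm2 (hg.mono_set (hunion ▸ subset_union_left))
    (hg.mono_set (hunion ▸ subset_union_right))]

/-- **The shell representation at time `t`** (BS15 Step 4, quantitative): for `L < |y| < 2L`,
`4L ≤ R = ρ₀(T−t)^{−γ}`,
`q(y) + p̃[ũ_t](0) = p̃[1_A v](y) + J₁[v](y) + J₃[v](y) + (∫_{|z|≥R} K(y−z)(ũ_t z) − ∫_{|z|≥R} K(y−z)(v z))`.
[cite: BronziShvydkoy2015, §2 Lemma 2.1, Step 4] -/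
theorem pressureProfile_repr_at_time
    (hsol : IsClassicalEulerSolutionOn (Ico 0 T) 0 u p)
    (hreg : ∀ T'' < T, HasBoundedSobolevNormsOn (Icc 0 T'') u) (hv : Continuous v)
    (hss : ∀ t ∈ Ico 0 T, ∀ x ∈ ball x₀ ρ₀, u t x = selfSimilarCollapse γ T v t (x - x₀))
    (hqp : ∀ t ∈ Ico 0 T, ∀ x ∈ ball x₀ ρ₀,
      p t x = (T - t) ^ (2 * (γ - 1)) * q ((T - t) ^ (-γ) • (x - x₀)) + p t x₀)
    {t : ℝ} (ht : t ∈ Ioo 0 T) {L : ℝ} (hL : 0 < L) (hLR : 4 * L ≤ ρ₀ * (T - t) ^ (-γ))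
    (hfar : IntegrableOn (fun z => ‖v z‖ ^ 2 / ‖z‖ ^ 3) {z : EuclideanSpace ℝ (Fin 3) | 4 * L ≤ ‖z‖} volume)
    {y : EuclideanSpace ℝ (Fin 3)} (hy : L < ‖y‖ ∧ ‖y‖ < 2 * L) :
    q y + normalisedPressure (fun z => (T - t) ^ (1 - γ) • u t (x₀ + (T - t) ^ γ • z)) 0 =
      normalisedPressure ({z : EuclideanSpace ℝ (Fin 3) | L / 2 ≤ ‖z‖ ∧ ‖z‖ < 4 * L}.indicator v) y +
        (∫ z in ball (0 : EuclideanSpace ℝ (Fin 3)) (L / 2), pressureKernel (y - z) (v z)) +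
        (∫ z in {z : EuclideanSpace ℝ (Fin 3) | 4 * L ≤ ‖z‖}, pressureKernel (y - z) (v z)) +
        ((∫ z in {z : EuclideanSpace ℝ (Fin 3) | ρ₀ * (T - t) ^ (-γ) ≤ ‖z‖},
            pressureKernel (y - z) (((T - t) ^ (1 - γ) • u t (x₀ + (T - t) ^ γ • z)))) -
          ∫ z in {z : EuclideanSpace ℝ (Fin 3) | ρ₀ * (T - t) ^ (-γ) ≤ ‖z‖},
            pressureKernel (y - z) (v z)) := by
  have htI : t ∈ Ico 0 T := ⟨ht.1.le, ht.2⟩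
  set R : ℝ := ρ₀ * (T - t) ^ (-γ) with hR
  set w : EuclideanSpace ℝ (Fin 3) → EuclideanSpace ℝ (Fin 3) :=
    fun z => (T - t) ^ (1 - γ) • u t (x₀ + (T - t) ^ γ • z) with hw
  set A : Set (EuclideanSpace ℝ (Fin 3)) := {z | L / 2 ≤ ‖z‖ ∧ ‖z‖ < 4 * L} with hA
  have hAm : MeasurableSet A := measurableSet_annulus L
  -- the rescaled slice: smooth, finite energy, equal to `v` on `|z| < R`
  have hwc : Continuous w := (contDiff_rescaledSlice (γ := γ) (x₀ := x₀) hsol htI 0).continuous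
  have hw1 : ContDiff ℝ 1 w := contDiff_rescaledSlice hsol htI 1
  have hw2 : Integrable (fun z => ‖w z‖ ^ 2) := (integrable_rescaledSlice_sq hsol hreg htI).1
  have hwv : ∀ z : EuclideanSpace ℝ (Fin 3), ‖z‖ < R → w z = v z := fun z hz =>
    rescaledSlice_eq hss htI hz
  -- the splitting for `w`
  obtain ⟨Λ, hΛ⟩ := hasPressurePV_of_contDiff_holds w hw1
    (lintegral_enorm_sq_lt_top_of_integrable_sq hw2) y
  have h1w : IntegrableOn (fun z => ‖w z‖ ^ 2) (ball (0 : EuclideanSpace ℝ (Fin 3)) (L / 2)) volume :=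
    hw2.integrableOn
  have h3w : IntegrableOn (fun z => ‖w z‖ ^ 2 / ‖z‖ ^ 3)
      {z : EuclideanSpace ℝ (Fin 3) | 4 * L ≤ ‖z‖} volume :=
    integrableOn_far_weight_of_integrable_sq hwc hw2 (by linarith)
  have hsplit := normalisedPressure_eq_indicator_add hwc.aestronglyMeasurable hL hy ⟨Λ, hΛ⟩ h1w h3w
  -- the pieces seen by `v`
  have hind : A.indicator w = A.indicator v := by
    funext z
    by_cases hz : z ∈ A
    · rw [indicator_of_mem hz, indicator_of_mem hz, hwv z (by linarith [hz.2])]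
    · rw [indicator_of_notMem hz, indicator_of_notMem hz]
  have hJ1 : ∫ z in ball (0 : EuclideanSpace ℝ (Fin 3)) (L / 2), pressureKernel (y - z) (w z) =
      ∫ z in ball (0 : EuclideanSpace ℝ (Fin 3)) (L / 2), pressureKernel (y - z) (v z) := by
    refine setIntegral_congr_fun measurableSet_ball fun z hz => ?_
    rw [mem_ball_zero_iff] at hz
    rw [hwv z (by linarith)]
  -- split the two far integrals at `R`
  have hy2 : 2 * ‖y‖ ≤ 4 * L := by linarith [hy.2]
  have hfw : IntegrableOn (fun z => pressureKernel (y - z) (w z))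
      {z : EuclideanSpace ℝ (Fin 3) | 4 * L ≤ ‖z‖} volume :=
    integrableOn_kernel_far hwc.aestronglyMeasurable (by linarith) hy2 h3w
  have hfv : IntegrableOn (fun z => pressureKernel (y - z) (v z))
      {z : EuclideanSpace ℝ (Fin 3) | 4 * L ≤ ‖z‖} volume :=
    integrableOn_kernel_far hv.aestronglyMeasurable (by linarith) hy2 hfar
  have hsw := setIntegral_far_split hLR hfw
  have hsv := setIntegral_far_split hLR hfv
  have hmid : ∫ z in {z : EuclideanSpace ℝ (Fin 3) | 4 * L ≤ ‖z‖ ∧ ‖z‖ < R}, pressureKernel (y - z) (w z) =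
      ∫ z in {z : EuclideanSpace ℝ (Fin 3) | 4 * L ≤ ‖z‖ ∧ ‖z‖ < R}, pressureKernel (y - z) (v z) := by
    refine setIntegral_congr_fun ((isClosed_le continuous_const continuous_norm).measurableSet.inter
      (isOpen_lt continuous_norm continuous_const).measurableSet) fun z hz => ?_
    rw [hwv z hz.2]
  rw [pressureProfile_eq_normalisedPressure_rescaledSlice hsol hreg hqp ht (by linarith [hy.2]),
    sub_add_cancel]
  rw [hind, hJ1, hsw, hmid] at hsplit
  rw [hsplit, hsv]
  ring

/-- **The `ũ`-tail**: `|∫_{|z|≥R} K(y−z)(ũ_t z)| ≤ (4/π) ρ₀⁻³ ‖u(0)‖₂² (T−t)^{2−2γ}` for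
`R = ρ₀(T−t)^{−γ} ≥ 2|y|`. [cite: BronziShvydkoy2015, §2 Lemma 2.1, Step 4 (the bound on p̃)] -/
theorem abs_tail_rescaledSlice_le (hρ₀ : 0 < ρ₀)
    (hsol : IsClassicalEulerSolutionOn (Ico 0 T) 0 u p)
    (hreg : ∀ T'' < T, HasBoundedSobolevNormsOn (Icc 0 T'') u)
    {t : ℝ} (ht : t ∈ Ico 0 T) {y : EuclideanSpace ℝ (Fin 3)} (hy : 2 * ‖y‖ ≤ ρ₀ * (T - t) ^ (-γ)) :
    |∫ z in {z : EuclideanSpace ℝ (Fin 3) | ρ₀ * (T - t) ^ (-γ) ≤ ‖z‖},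
        pressureKernel (y - z) (((T - t) ^ (1 - γ) • u t (x₀ + (T - t) ^ γ • z)))| ≤
      4 / Real.pi * ρ₀⁻¹ ^ 3 * (∫ x, ‖u 0 x‖ ^ 2) * (T - t) ^ (2 - 2 * γ) := by
  have hs : 0 < T - t := by linarith [ht.2]
  set R : ℝ := ρ₀ * (T - t) ^ (-γ) with hR
  have hR0 : 0 < R := mul_pos hρ₀ (Real.rpow_pos_of_pos hs _)
  set w : EuclideanSpace ℝ (Fin 3) → EuclideanSpace ℝ (Fin 3) :=
    fun z => (T - t) ^ (1 - γ) • u t (x₀ + (T - t) ^ γ • z) with hw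
  have hwc : Continuous w := (contDiff_rescaledSlice (γ := γ) (x₀ := x₀) hsol ht 0).continuous
  have hw2 : Integrable (fun z => ‖w z‖ ^ 2) := (integrable_rescaledSlice_sq hsol hreg ht).1
  have h3 := integrableOn_far_weight_of_integrable_sq hwc hw2 hR0
  have hb := abs_integral_kernel_far_le (w := w) hR0 hy h3
  have hfw := setIntegral_far_weight_le hwc hw2 hR0
  have hE := integral_rescaledSlice_sq_le (γ := γ) (x₀ := x₀) hsol hreg ht
  have hE0 : 0 ≤ ∫ x, ‖u 0 x‖ ^ 2 := integral_nonneg fun _ => sq_nonneg _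
  calc |∫ z in {z : EuclideanSpace ℝ (Fin 3) | R ≤ ‖z‖}, pressureKernel (y - z) (w z)|
      ≤ 4 / Real.pi * ∫ z in {z : EuclideanSpace ℝ (Fin 3) | R ≤ ‖z‖}, ‖w z‖ ^ 2 / ‖z‖ ^ 3 := hb
    _ ≤ 4 / Real.pi * (R⁻¹ ^ 3 * ((T - t) ^ (2 - 5 * γ) * ∫ x, ‖u 0 x‖ ^ 2)) := by
        gcongr
        exact hfw.trans (mul_le_mul_of_nonneg_left hE (by positivity))
    _ = 4 / Real.pi * ρ₀⁻¹ ^ 3 * (∫ x, ‖u 0 x‖ ^ 2) * (T - t) ^ (2 - 2 * γ) := by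
        have e : R⁻¹ ^ 3 * (T - t) ^ (2 - 5 * γ) = ρ₀⁻¹ ^ 3 * (T - t) ^ (2 - 2 * γ) := by
          have e1 : R⁻¹ = ρ₀⁻¹ * (T - t) ^ γ := by
            rw [hR, mul_inv, Real.rpow_neg hs.le, inv_inv]
          have e2 : ((T - t) ^ γ) ^ 3 * (T - t) ^ (2 - 5 * γ) = (T - t) ^ (2 - 2 * γ) := by
            rw [← Real.rpow_natCast ((T - t) ^ γ) 3, ← Real.rpow_mul hs.le, ← Real.rpow_add hs]
            congr 1; push_cast; ring
          rw [e1, mul_pow, mul_assoc, e2]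
        calc 4 / Real.pi * (R⁻¹ ^ 3 * ((T - t) ^ (2 - 5 * γ) * ∫ x, ‖u 0 x‖ ^ 2))
            = 4 / Real.pi * (R⁻¹ ^ 3 * (T - t) ^ (2 - 5 * γ)) * ∫ x, ‖u 0 x‖ ^ 2 := by ring
          _ = _ := by rw [e]; ring

/-- The far-weight tail `∫_{|z|≥R} |v|²/|z|³` tends to `0` as `R → ∞`. [folklore] -/
private theorem tendsto_far_weight_tail {R₀ : ℝ}
    (hfar : IntegrableOn (fun z => ‖v z‖ ^ 2 / ‖z‖ ^ 3) {z : EuclideanSpace ℝ (Fin 3) | R₀ ≤ ‖z‖} volume) :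
    Tendsto (fun R : ℝ => ∫ z in {z : EuclideanSpace ℝ (Fin 3) | R ≤ ‖z‖}, ‖v z‖ ^ 2 / ‖z‖ ^ 3)
      atTop (𝓝 0) := by
  have hsm : ∀ R : ℝ, MeasurableSet {z : EuclideanSpace ℝ (Fin 3) | R ≤ ‖z‖} := fun R =>
    (isClosed_le continuous_const continuous_norm).measurableSet
  have hanti : Antitone fun R : ℝ => {z : EuclideanSpace ℝ (Fin 3) | R ≤ ‖z‖} :=
    fun R₁ R₂ h z hz => le_trans h hz
  have h := tendsto_setIntegral_of_antitone hsm hanti ⟨R₀, hfar⟩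
  have hempty : (⋂ R : ℝ, {z : EuclideanSpace ℝ (Fin 3) | R ≤ ‖z‖}) = ∅ := by
    ext z
    simp only [mem_iInter, mem_setOf_eq, mem_empty_iff_false, iff_false, not_forall, not_le]
    exact ⟨‖z‖ + 1, by linarith⟩
  rwa [hempty, Measure.restrict_empty, integral_zero_measure] at h

/-- The far weight of a continuous field, integrable near infinity, is integrable on every
`{|z| ≥ R}`, `R > 0`. [folklore] -/
private theorem integrableOn_far_weight_of_pos (hv : Continuous v)
    (hfar : IntegrableOn (fun z => ‖v z‖ ^ 2 / ‖z‖ ^ 3) {z : EuclideanSpace ℝ (Fin 3) | 1 ≤ ‖z‖} volume)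
    {R : ℝ} (hR : 0 < R) :
    IntegrableOn (fun z => ‖v z‖ ^ 2 / ‖z‖ ^ 3) {z : EuclideanSpace ℝ (Fin 3) | R ≤ ‖z‖} volume := by
  have hK : IsCompact {z : EuclideanSpace ℝ (Fin 3) | R ≤ ‖z‖ ∧ ‖z‖ ≤ 1} := by
    refine (isCompact_closedBall (0 : EuclideanSpace ℝ (Fin 3)) 1).of_isClosed_subset
      ((isClosed_le continuous_const continuous_norm).inter (isClosed_le continuous_norm continuous_const))
      fun z hz => ?_
    rw [mem_closedBall_zero_iff]; exact hz.2
  have hcont : ContinuousOn (fun z : EuclideanSpace ℝ (Fin 3) => ‖v z‖ ^ 2 / ‖z‖ ^ 3)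
      {z | R ≤ ‖z‖ ∧ ‖z‖ ≤ 1} := by
    refine ((hv.norm.pow 2).continuousOn).div (continuous_norm.pow 3).continuousOn fun z hz => ?_
    exact (pow_pos (hR.trans_le hz.1) 3).ne'
  have h1 : IntegrableOn (fun z => ‖v z‖ ^ 2 / ‖z‖ ^ 3) {z : EuclideanSpace ℝ (Fin 3) | R ≤ ‖z‖ ∧ ‖z‖ ≤ 1}
      volume := hcont.integrableOn_compact hK
  refine (h1.union hfar).mono_set fun z hz => ?_
  by_cases h : ‖z‖ ≤ 1
  · exact Or.inl ⟨hz, h⟩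
  · exact Or.inr (le_of_lt (not_le.1 h))

/-- `R(t) = ρ₀ (T−t)^{−γ} → ∞` as `t ↑ T`. [folklore] -/
private theorem tendsto_rescaledRadius_atTop (hγ : 0 < γ) (hρ₀ : 0 < ρ₀) :
    Tendsto (fun t : ℝ => ρ₀ * (T - t) ^ (-γ)) (𝓝[<] T) atTop := by
  have h0 : Tendsto (fun t : ℝ => T - t) (𝓝[<] T) (𝓝[>] 0) := by
    refine tendsto_nhdsWithin_iff.2 ⟨?_, ?_⟩
    · have h : Tendsto (fun t : ℝ => T - t) (𝓝 T) (𝓝 (T - T)) := tendsto_const_nhds.sub tendsto_id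
      rw [sub_self] at h
      exact h.mono_left nhdsWithin_le_nhds
    · filter_upwards [self_mem_nhdsWithin] with t ht
      exact sub_pos.2 (mem_Iio.1 ht)
  have h1 : Tendsto (fun s : ℝ => (s⁻¹) ^ γ) (𝓝[>] 0) atTop :=
    (tendsto_rpow_atTop hγ).comp tendsto_inv_nhdsGT_zero
  have h2 : Tendsto (fun s : ℝ => s ^ (-γ)) (𝓝[>] 0) atTop := by
    refine h1.congr' ?_
    filter_upwards [self_mem_nhdsWithin] with s hs
    rw [Real.rpow_neg (le_of_lt hs), Real.inv_rpow (le_of_lt hs)]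
  exact (h2.comp h0).const_mul_atTop hρ₀

/-- `(T−t)^{a} → 0` as `t ↑ T`, `a > 0`. [folklore] -/
private theorem tendsto_rpow_sub_nhdsLT {a : ℝ} (ha : 0 < a) :
    Tendsto (fun t : ℝ => (T - t) ^ a) (𝓝[<] T) (𝓝 0) := by
  have h0 : Tendsto (fun t : ℝ => T - t) (𝓝 T) (𝓝 0) := by
    have h : Tendsto (fun t : ℝ => T - t) (𝓝 T) (𝓝 (T - T)) := tendsto_const_nhds.sub tendsto_id
    rwa [sub_self] at h
  have h1 : Tendsto (fun s : ℝ => s ^ a) (𝓝 0) (𝓝 0) := by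
    have := (Real.continuousAt_rpow_const 0 a (Or.inr ha.le)).tendsto
    rwa [Real.zero_rpow ha.ne'] at this
  exact (h1.comp h0).mono_left nhdsWithin_le_nhds

/-- **BS15 Lemma 2.1: the self-similar pressure and its shell representation.** In the setting
of `bronziShvydkoy2015_energy_dichotomy` (classical Euler solution on `ℝ³ × [0,T)` in the BKM
class, locally self-similar on `B_{ρ₀}(x₀)` with a `C²` profile `v`, exponent `γ ∈ (0,1)`) and with
the far weight `|v|²/|z|³` integrable near infinity, there is a pressure profile `P` — the tree's
recovered pressure `q` shifted by a constant, i.e. the printed `q = −|v|²/N + ∫ K_{ij}(·−z)vᵢvⱼ(z)dz`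
((2.2)) — with `(v, P)` solving the self-similar Euler system (2.3) and, on every dyadic shell
`L < |y| < 2L`, `P(y) = p̃[1_A v](y) + ∫_{|z|<L/2} K(y−z)(v z) dz + ∫_{|z|≥4L} K(y−z)(v z) dz`,
`A = {L/2 ≤ |z| < 4L}` (limit `t ↑ T` of the representation at time `t`: the `ũ_t`-tail is
`O((T−t)^{2−2γ})`, the `v`-tail `o(1)`). [cite: BronziShvydkoy2015, §2 Lemma 2.1] -/
theorem exists_pressureProfile_shell_repr (hT : 0 < T) (hγ : 0 < γ) (hγ1 : γ < 1) (hρ₀ : 0 < ρ₀)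
    (hsol : IsClassicalEulerSolutionOn (Ico 0 T) 0 u p)
    (hreg : ∀ T'' < T, HasBoundedSobolevNormsOn (Icc 0 T'') u) (hv : ContDiff ℝ 2 v)
    (hss : ∀ t ∈ Ico 0 T, ∀ x ∈ ball x₀ ρ₀, u t x = selfSimilarCollapse γ T v t (x - x₀))
    (hfar : IntegrableOn (fun z => ‖v z‖ ^ 2 / ‖z‖ ^ 3) {z : EuclideanSpace ℝ (Fin 3) | 1 ≤ ‖z‖} volume) :
    ∃ P : EuclideanSpace ℝ (Fin 3) → ℝ, IsSelfSimilarEulerProfile γ 0 v P ∧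
      ∀ L : ℝ, 0 < L → ∀ y : EuclideanSpace ℝ (Fin 3), L < ‖y‖ ∧ ‖y‖ < 2 * L →
        P y = normalisedPressure
            ({z : EuclideanSpace ℝ (Fin 3) | L / 2 ≤ ‖z‖ ∧ ‖z‖ < 4 * L}.indicator v) y +
          (∫ z in ball (0 : EuclideanSpace ℝ (Fin 3)) (L / 2), pressureKernel (y - z) (v z)) +
          ∫ z in {z : EuclideanSpace ℝ (Fin 3) | 4 * L ≤ ‖z‖}, pressureKernel (y - z) (v z) := by
  obtain ⟨q, hq, hqp⟩ := exists_pressureProfile_of_locallySelfSimilar hT hγ hρ₀ hsol hv hss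
  have hvc : Continuous v := hv.continuous
  have hfarL : ∀ L : ℝ, 0 < L →
      IntegrableOn (fun z => ‖v z‖ ^ 2 / ‖z‖ ^ 3) {z : EuclideanSpace ℝ (Fin 3) | 4 * L ≤ ‖z‖} volume :=
    fun L hL => integrableOn_far_weight_of_pos hvc hfar (by linarith)
  -- the time-dependent constant and the shell right-hand side
  set c : ℝ → ℝ := fun t =>
    normalisedPressure (fun z => (T - t) ^ (1 - γ) • u t (x₀ + (T - t) ^ γ • z)) 0 with hc
  set RHS : ℝ → EuclideanSpace ℝ (Fin 3) → ℝ := fun L y =>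
    normalisedPressure ({z : EuclideanSpace ℝ (Fin 3) | L / 2 ≤ ‖z‖ ∧ ‖z‖ < 4 * L}.indicator v) y +
      (∫ z in ball (0 : EuclideanSpace ℝ (Fin 3)) (L / 2), pressureKernel (y - z) (v z)) +
      ∫ z in {z : EuclideanSpace ℝ (Fin 3) | 4 * L ≤ ‖z‖}, pressureKernel (y - z) (v z) with hRHS
  set Φ : ℝ → ℝ := fun R => ∫ z in {z : EuclideanSpace ℝ (Fin 3) | R ≤ ‖z‖}, ‖v z‖ ^ 2 / ‖z‖ ^ 3 with hΦ
  have hΦt : Tendsto Φ atTop (𝓝 0) := tendsto_far_weight_tail hfar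
  have hRt := tendsto_rescaledRadius_atTop (T := T) hγ hρ₀
  set Aw : ℝ := 4 / Real.pi * ρ₀⁻¹ ^ 3 * ∫ x, ‖u 0 x‖ ^ 2 with hAw
  -- the limit of `c` seen from any shell point
  have hclaim : ∀ L : ℝ, 0 < L → ∀ y : EuclideanSpace ℝ (Fin 3), L < ‖y‖ ∧ ‖y‖ < 2 * L →
      Tendsto c (𝓝[<] T) (𝓝 (RHS L y - q y)) := by
    intro L hL y hy
    have hev : ∀ᶠ t in 𝓝[<] T, t ∈ Ioo 0 T ∧ 4 * L ≤ ρ₀ * (T - t) ^ (-γ) := by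
      have h1 : ∀ᶠ t in 𝓝[<] T, 0 < t := nhdsWithin_le_nhds (eventually_gt_nhds hT)
      have h2 : ∀ᶠ t in 𝓝[<] T, t < T := self_mem_nhdsWithin
      have h3 : ∀ᶠ t in 𝓝[<] T, 4 * L ≤ ρ₀ * (T - t) ^ (-γ) := hRt.eventually (eventually_ge_atTop _)
      filter_upwards [h1, h2, h3] with t h1 h2 h3 using ⟨⟨h1, h2⟩, h3⟩
    have hbound : ∀ᶠ t in 𝓝[<] T, ‖c t - (RHS L y - q y)‖ ≤
        Aw * (T - t) ^ (2 - 2 * γ) + 4 / Real.pi * Φ (ρ₀ * (T - t) ^ (-γ)) := by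
      filter_upwards [hev] with t ht
      have hrepr := pressureProfile_repr_at_time hsol hreg hvc hss hqp ht.1 hL ht.2 (hfarL L hL) hy
      have hy2 : 2 * ‖y‖ ≤ ρ₀ * (T - t) ^ (-γ) := by linarith [hy.2, ht.2]
      have htI : t ∈ Ico 0 T := ⟨ht.1.1.le, ht.1.2⟩
      have hs : 0 < T - t := by linarith [ht.1.2]
      have hR0 : 0 < ρ₀ * (T - t) ^ (-γ) := mul_pos hρ₀ (Real.rpow_pos_of_pos hs _)
      have htw := abs_tail_rescaledSlice_le (γ := γ) (x₀ := x₀) hρ₀ hsol hreg htI hy2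
      have htv := abs_integral_kernel_far_le (w := v) hR0 hy2
        ((hfarL L hL).mono_set fun z hz => le_trans ht.2 hz)
      rw [Real.norm_eq_abs]
      have e : c t - (RHS L y - q y) =
          (∫ z in {z : EuclideanSpace ℝ (Fin 3) | ρ₀ * (T - t) ^ (-γ) ≤ ‖z‖},
              pressureKernel (y - z) (((T - t) ^ (1 - γ) • u t (x₀ + (T - t) ^ γ • z)))) -
            ∫ z in {z : EuclideanSpace ℝ (Fin 3) | ρ₀ * (T - t) ^ (-γ) ≤ ‖z‖},
              pressureKernel (y - z) (v z) := by
        rw [hc, hRHS]; dsimp only; linarith [hrepr]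
      rw [e]
      exact (abs_sub _ _).trans (add_le_add htw htv)
    have hlim : Tendsto (fun t => Aw * (T - t) ^ (2 - 2 * γ) + 4 / Real.pi * Φ (ρ₀ * (T - t) ^ (-γ)))
        (𝓝[<] T) (𝓝 0) := by
      have h1 := (tendsto_rpow_sub_nhdsLT (T := T) (a := 2 - 2 * γ) (by linarith)).const_mul Aw
      have h2 := (hΦt.comp hRt).const_mul (4 / Real.pi)
      rw [mul_zero] at h1 h2
      simpa using h1.add h2
    have h0 := squeeze_zero_norm' hbound hlim
    exact tendsto_sub_nhds_zero_iff.1 h0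
  -- the constant: read off at one shell point
  obtain ⟨y₀, hny₀⟩ := exists_norm_eq (EuclideanSpace ℝ (Fin 3)) (by norm_num : (0 : ℝ) ≤ 3 / 2)
  have hy₀S : (1 : ℝ) < ‖y₀‖ ∧ ‖y₀‖ < 2 * 1 := by rw [hny₀]; norm_num
  set κ : ℝ := RHS 1 y₀ - q y₀ with hκ
  have hκlim : Tendsto c (𝓝[<] T) (𝓝 κ) := hclaim 1 one_pos y₀ hy₀S
  refine ⟨fun y => q y + κ, ?_, ?_⟩
  · refine ⟨hq.contDiff_velocity, hq.contDiff_pressure.add contDiff_const, fun y => ?_, hq.divFree⟩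
    have hg : gradient (fun y => q y + κ) y = gradient q y := by
      unfold gradient
      rw [fderiv_add_const]
    rw [hg]
    exact hq.profile_eq y
  · intro L hL y hy
    have h := tendsto_nhds_unique (hclaim L hL y hy) hκlim
    show q y + κ = RHS L y
    linarith

/-- **BS15 Lemma 2.1, the dyadic pressure law (2.4) (`r = 3/2`).** There is a universal `K ≥ 0`:
in the setting of `bronziShvydkoy2015_energy_dichotomy` (with `γ ∈ (0,1)`, far weight of the
profile integrable near infinity) there is a pressure profile `P` with `(v, P)` a self-similar Euler
profile pair and, for every `L > 0`,
`(∫_{L<|y|<2L} |P|^{3/2})^{2/3} ≤ K ((∫_{L/2≤|z|<4L} |v|³)^{2/3} + L² (L⁻³ ∫_{|z|<L/2} |v|² + ∫_{|z|≥4L} |v|²/|z|³))`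
— the un-averaged form of BS15 (2.4): `⟨|q|^{3/2}⟩^{2/3}_{L,2L} ≲ ⟨|v|²⟩_L + ⟨|v|³⟩^{2/3}_{L/2,4L} +
Σ_k ⟨|v|²⟩_{2^kL,2^{k+1}L}`. [cite: BronziShvydkoy2015, §2 Lemma 2.1 eq. (2.4)] -/
theorem exists_pressureProfile_shell_bound :
    ∃ K : ℝ, 0 ≤ K ∧ ∀ (T γ ρ₀ : ℝ) (x₀ : EuclideanSpace ℝ (Fin 3))
      (u : ℝ → EuclideanSpace ℝ (Fin 3) → EuclideanSpace ℝ (Fin 3))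
      (p : ℝ → EuclideanSpace ℝ (Fin 3) → ℝ) (v : EuclideanSpace ℝ (Fin 3) → EuclideanSpace ℝ (Fin 3)),
      0 < T → 0 < γ → γ < 1 → 0 < ρ₀ →
      IsClassicalEulerSolutionOn (Ico 0 T) 0 u p →
      (∀ T'' < T, HasBoundedSobolevNormsOn (Icc 0 T'') u) → ContDiff ℝ 2 v →
      (∀ t ∈ Ico 0 T, ∀ x ∈ ball x₀ ρ₀, u t x = selfSimilarCollapse γ T v t (x - x₀)) →
      IntegrableOn (fun z => ‖v z‖ ^ 2 / ‖z‖ ^ 3) {z : EuclideanSpace ℝ (Fin 3) | 1 ≤ ‖z‖} volume →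
      ∃ P : EuclideanSpace ℝ (Fin 3) → ℝ, IsSelfSimilarEulerProfile γ 0 v P ∧
        ∀ L : ℝ, 0 < L →
          (∫ y in {y : EuclideanSpace ℝ (Fin 3) | L < ‖y‖ ∧ ‖y‖ < 2 * L}, |P y| ^ (3 / 2 : ℝ)) ^ (2 / 3 : ℝ) ≤
            K * ((∫ z in {z : EuclideanSpace ℝ (Fin 3) | L / 2 ≤ ‖z‖ ∧ ‖z‖ < 4 * L}, ‖v z‖ ^ (3 : ℝ)) ^ (2 / 3 : ℝ) +
              L ^ 2 * (L⁻¹ ^ 3 * (∫ z in ball (0 : EuclideanSpace ℝ (Fin 3)) (L / 2), ‖v z‖ ^ 2) +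
                ∫ z in {z : EuclideanSpace ℝ (Fin 3) | 4 * L ≤ ‖z‖}, ‖v z‖ ^ 2 / ‖z‖ ^ 3)) := by
  obtain ⟨K, hK0, hK⟩ := exists_shell_threeHalves_bound
  refine ⟨K, hK0, ?_⟩
  intro T γ ρ₀ x₀ u p v hT hγ hγ1 hρ₀ hsol hreg hv hss hfar
  obtain ⟨P, hP, hrepr⟩ := exists_pressureProfile_shell_repr hT hγ hγ1 hρ₀ hsol hreg hv hss hfar
  refine ⟨P, hP, fun L hL => ?_⟩
  have hPc : Continuous P := hP.contDiff_pressure.continuous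
  have hSbdd : Bornology.IsBounded {y : EuclideanSpace ℝ (Fin 3) | L < ‖y‖ ∧ ‖y‖ < 2 * L} :=
    (isBounded_ball (x := (0 : EuclideanSpace ℝ (Fin 3))) (r := 2 * L)).subset fun y hy => by
      rw [mem_ball_zero_iff]; exact hy.2
  have hPi : IntegrableOn (fun y => |P y| ^ (3 / 2 : ℝ))
      {y : EuclideanSpace ℝ (Fin 3) | L < ‖y‖ ∧ ‖y‖ < 2 * L} volume :=
    memLp_one_iff_integrable.1 (memLp_restrict_of_continuous_isBounded
      ((continuous_abs.comp hPc).rpow_const fun _ => Or.inr (by norm_num)) hSbdd 1)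
  exact hK v L P hv.continuous hL (integrableOn_far_weight_of_pos hv.continuous hfar (by linarith))
    hPi (hrepr L hL)

end LocallySelfSimilar

end BronziShvydkoy2015

end Literature.Analysis.FluidPDE
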